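import Literature.Analysis.FluidPDE.KatoAprioriForcedClassical
import Literature.Analysis.FluidPDE.NSForcedLerayRateHolds
import Literature.Analysis.FluidPDE.TaoSmoothExistenceForcedFullSlab
import Literature.Analysis.FluidPDE.LerayH1ContinuationForced
import HarnessLib

/-!
# Kato's small-data theorem WITH a confined Clay-class force, classical output
# (Kato 1984, Thm. 2–4; Lemarié-Rieusset 2016, Thm. 15.2 with Thm. 7.2/7.3)

Analysis/FluidPDE proof file (cell `pub/ns-blowup`, seat `ns-blowup-lit` g12; theorems only, no
definitions, no named facts). It proves, as a Literature theorem in the exact binder shape of the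
cell's typed hypothesis `SmallDataClassicalEngine ν`
(`Summits/NavierStokesRegularity/FluidComputer/PalasekTowerRegisterGlobalSmallData.lean`; the `H` of
the negative lemma `EpisodeBaseNegative.firstEpisodeR_false_of_engine`), Kato's small-data theory of the
incompressible Navier–Stokes system on `ℝ³` WITH a bounded, confined, Clay-class force, in the output
form a classical-solution interface consumes:

* `kato_smallData_forced_classical` — for `ν > 0` there is `ε > 0` such that: for every slab
  `[t₀, t₁]` (`0 ≤ t₀ < t₁`, `W := t₁ - t₀`), every smooth compactly supported divergence-free datum
  `u₀`, every force `g` smooth on the closed half-space with Fefferman's decay, vanishing off `B̄(0, R)`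
  and bounded by `M` on the slab, IF `δ₁ + δ₂ + δ₃ ≤ ε` (`δ₁ = ‖u₀‖₃/ν`, `δ₂ = W^{1/2} M R²/ν^{3/2}`,
  `δ₃ = W^{3/4} M R^{3/2}/ν^{5/4}`), THEN there is a classical solution `(v, q)` of the forced system
  on `[t₀, t₁] × ℝ³` with `v(t₀) = u₀`, bounded, of finite energy, with
  `|v(t₁, x)| ≤ ε⁻¹ (δ₁ + δ₂ + δ₃) (ν/W)^{1/2}` for all `x`.

WHAT THIS IS NOT: not a statement about Navier–Stokes regularity or blow-up in general — a small-data
existence-with-bounds theorem for GIVEN data and force.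

## The proof (all inputs are theorems of the tree)

1. *A-priori bound* (`KatoAprioriForced.kato_apriori_forced`, Kato 1984 (2.3)–(2.5) run on the
   forced Oseen representation of a classical solution): in Kato's classes `t^{1/4}L⁶ ∩ t^{1/2}L^∞`
   every Tao-class classical solution on `[0, S]`, `S ≤ W`, from `u₀` obeys
   `|u(t, x)| ≤ K δ_A ν^{1/2} t^{-1/2}` with `δ_A = ‖u₀‖₃/ν + W^{3/4} G₂/ν^{5/4} ≤ ε_A`, after re-gauging
   the force to its Leray projection `P g` (`IsClassicalNSSolutionOn.to_clayProjForce`, Tao 2013 (8)),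
   whose slices have `‖P g(t)‖₂ ≤ 4√3 ‖g(t)‖₂ ≤ 4√3 M |B_R|^{1/2}` (`eLpNorm_two_clayProjForce_le`,
   Plancherel); the `L⁶`-continuity of the slices comes from the `L²`-continuity of Tao's class and
   the sup bound (`continuousOn_eLpNorm_six_of_continuousInLpOn_two`).
2. *No enstrophy blow-up under the Kato sup bound* (`enstrophy_le_exp_of_norm_le_forced`: the
   explicit form `∫|∇u(t)|² ≤ e^{κK²t}(∫|∇u₀|² + ν⁻¹F₀t)` of Lemarié-Rieusset 2016, Thm. 11.2 at
   `(p,q) = (2,∞)`, i.e. the bound inside `ForcedEnstrophyOfSupNorm.exists_enstrophy_le_of_norm_le_forced`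
   made uniform in the solution) and Tao's forced energy bound (Lemma 8.1) give a UNIFORM `H¹` bound
   at every restarting time.
3. *Uniform-step continuation*: Tao's forced smooth existence on a full slab
   (`smooth_existence_forced_fullSlab` with the discharged `tao2011_smooth_local_existence_forced_holds`,
   Thm. 5.4 (ii)+(iv)) restarts from `u(S - h/2)` with a step `h` fixed by the uniform `H¹` bound, and
   the Tao-class gluing `taoClass_glue_forced` extends the solution by `h/2`; induction reaches `W`
   (Lemarié-Rieusset 2016, Thm. 7.2/7.3: the mild `H^∞` solution lives as long as it stays bounded).
4. *Time shift* `t ↦ t - t₀` (`IsClassicalNSSolutionOn.comp_add_right`, Clay-force shifts of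
   `ClayForceTimeShift.lean`).

## Mathlib / tree search

`lean search 'smallData|SmallData|kato.*forced'`: only the Summits hypothesis (typed, unproved) and
the unforced tree theorems `kato_global_small_holds`, `clay_solution_of_hasGlobalKatoSolution_holds`,
`exists_kato_clay_threshold` (refuter KJ-12). Reused by name: see the proof sketch above, plus
`linfty_bound_of_hasBoundedSobolevNormsOn_holds`, `tao2011_forced_finiteEnergy_energyBound_holds`,
`clayForce_lintegral_sqrt_eH1NormSq_translate_le`, `ForcedEnstrophyOfSupNorm.exists_piece_rate`,
`lintegral_levelSq_synthVel_eq_of_moments`, `IsClassicalNSSolutionOn.velocity_eq_of_hasBoundedSobolevNormsOn`.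

## References

* T. Kato, *Strong `L^p`-solutions of the Navier–Stokes equation in `ℝ^m`, with applications to weak
  solutions*, Math. Z. 187 (1984) 471–480, Thm. 2–4. [Kato1984]
* P. G. Lemarié-Rieusset, *The Navier–Stokes Problem in the 21st Century*, CRC Press (2016), Thm. 15.2,
  Thm. 7.2–7.3, Thm. 11.2, §6.1. [LemarieRieusset2016]
* T. Tao, *Localisation and compactness properties of the Navier–Stokes global regularity problem*,
  Anal. PDE 6 (2013) 25–107 = arXiv:1108.1165, Thm. 5.4, Lemma 8.1, (8). [Tao2011]
-/

noncomputable section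

open MeasureTheory TopologicalSpace Set Function Filter
open _root_.Topology
open scoped InnerProductSpace RealInnerProductSpace ENNReal NNReal FourierTransform ContDiff

namespace Literature.Analysis.FluidPDE

open FourierNS

namespace KatoSmallDataForced

/-! ### §0 The Leray projection of a slab force is `L²`-bounded by the force (crude constant `4√3`) -/

section Projection

variable {T : ℝ} {f : ℝ → EuclideanSpace ℝ (Fin 3) → EuclideanSpace ℝ (Fin 3)}
  (hT : 0 < T) (hf : IsSmoothSpaceTimeOn (Icc 0 T) f) (hd : HasUniformRapidDecayOn (Icc 0 T) f)

/-- The sup norm of a finite family of complex numbers is dominated by the `ℓ²` sum: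
`‖g ξ‖ₑ² ≤ ∑ₗ ‖g ξ l‖ₑ²`. [folklore] -/
private theorem enorm_sq_le_sum_enorm_sq (v : Fin 3 → ℂ) : ‖v‖ₑ ^ 2 ≤ ∑ l, ‖v l‖ₑ ^ 2 := by
  obtain ⟨l, -, hl⟩ := Finset.exists_mem_eq_sup (Finset.univ : Finset (Fin 3)) Finset.univ_nonempty
    fun b => ‖v b‖₊
  have hnorm : ‖v‖₊ = ‖v l‖₊ := by rw [Pi.nnnorm_def, hl]
  have h1 : ‖v‖ₑ = ‖v l‖ₑ := by
    rw [enorm_eq_nnnorm, enorm_eq_nnnorm, hnorm]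
  rw [h1]
  exact Finset.single_le_sum (f := fun l => ‖v l‖ₑ ^ 2) (fun _ _ => bot_le) (Finset.mem_univ l)

include hT hf hd in
/-- **`‖P f(t)‖_{L²} ≤ 4√3 ‖f(clamp t)‖_{L²}`** for the Leray projection `clayProjForce` of a
Schwartz-on-slab force (Plancherel for the synthesized fields `f(clamp t) = synthVel (forceData t)` and
`P f(t) = synthVel (lerayPart (forceData t))`, with the pointwise Fourier-side bound
`|lerayPart b(ξ)ₗ| ≤ (1 + 3)‖b(ξ)‖_∞`; the sharp constant is `1`). [cite: LemarieRieusset2016, §6.1]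
[cite: Tao2011, (8) p. 3] -/
theorem lintegral_enorm_sq_clayProjForce_le (t : ℝ) :
    ∫⁻ x, ‖clayProjForce hT hf hd t x‖ₑ ^ 2 ≤ 48 * ∫⁻ x, ‖f (clamp T t) x‖ₑ ^ 2 := by
  have hdim4 : Module.finrank ℝ (EuclideanSpace ℝ (Fin 3)) < 4 := by
    rw [finrank_euclideanSpace, Fintype.card_fin]; norm_num
  -- the raw Fourier force `V₀ = forceData t` and its Leray part `V`
  set V₀ := fun ξ => forceData hT hf hd t ξ with hV₀
  set V := fun ξ => lerayPart (forceData hT hf hd t) ξ with hV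
  have hmeas₀ : ∀ l, AEStronglyMeasurable (fun ξ => V₀ ξ l) volume := fun l =>
    ((continuous_apply l).comp (continuous_forceData_slice hT hf hd t)).aestronglyMeasurable
  have hmeas : ∀ l, AEStronglyMeasurable (fun ξ => V ξ l) volume := fun l =>
    aestronglyMeasurable_lerayPart_forceData_apply hT hf hd t l
  have hmom₀ : ∀ (k : ℕ) (l : Fin 3), Integrable (fun ξ : EuclideanSpace ℝ (Fin 3) => ‖ξ‖ ^ k * ‖V₀ ξ l‖) volume := by
    intro k l
    obtain ⟨B', -, hB'⟩ := hasDecay_forceData_uniform hT hf hd (k + 4)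
    exact ((hB' t).apply l).integrable_pow_mul_norm hdim4 (hmeas₀ l)
  have hmom : ∀ (k : ℕ) (l : Fin 3), Integrable (fun ξ : EuclideanSpace ℝ (Fin 3) => ‖ξ‖ ^ k * ‖V ξ l‖) volume := by
    intro k l
    obtain ⟨B', -, hB'⟩ := hasDecay_lerayPart_forceData_uniform hT hf hd (k + 4)
    exact ((hB' t).apply l).integrable_pow_mul_norm hdim4 (hmeas l)
  have hconj₀ : ∀ ξ l, V₀ (-ξ) l = starRingEnd ℂ (V₀ ξ l) := fun ξ l => forceData_conj_symm hT hf hd t ξ l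
  have hconj : ∀ ξ l, V (-ξ) l = starRingEnd ℂ (V ξ l) := fun ξ l =>
    lerayPart_forceData_conj_symm hT hf hd t ξ l
  -- square-integrable envelopes (order-`2` decay)
  obtain ⟨B₀, hB₀0, hB₀⟩ := hasDecay_forceData_uniform hT hf hd 2
  obtain ⟨B₁, hB₁0, hB₁⟩ := hasDecay_lerayPart_forceData_uniform hT hf hd 2
  have henv : ∀ B : ℝ, MemLp (fun ξ : EuclideanSpace ℝ (Fin 3) => B * ((1 + ‖ξ‖) ^ 2)⁻¹) 2 volume := by
    intro B
    have hGsq : ∀ ξ : EuclideanSpace ℝ (Fin 3), (B * ((1 + ‖ξ‖) ^ 2)⁻¹) ^ 2 = B ^ 2 * ((1 + ‖ξ‖) ^ 4)⁻¹ := by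
      intro ξ
      have h1 : 0 < 1 + ‖ξ‖ := by positivity
      field_simp
    have hGint : Integrable (fun ξ : EuclideanSpace ℝ (Fin 3) => (B * ((1 + ‖ξ‖) ^ 2)⁻¹) ^ 2) volume := by
      simp_rw [hGsq]
      exact (integrable_inv_one_add_norm_pow hdim4).const_mul _
    have hpow : Continuous fun ξ : EuclideanSpace ℝ (Fin 3) => (1 + ‖ξ‖) ^ 2 :=
      (continuous_const.add continuous_norm).pow 2
    have hGcont : Continuous fun ξ : EuclideanSpace ℝ (Fin 3) => B * ((1 + ‖ξ‖) ^ 2)⁻¹ :=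
      continuous_const.mul (hpow.inv₀ fun ξ => by positivity)
    exact (memLp_two_iff_integrable_sq hGcont.aestronglyMeasurable).2 hGint
  have hle₀ : ∀ ξ l, ‖ξ‖ ^ 0 * ‖V₀ ξ l‖ ≤ (fun (_ : Fin 3) ξ => B₀ * ((1 + ‖ξ‖) ^ 2)⁻¹) l ξ := fun ξ l => by
    rw [pow_zero, one_mul]; exact (hB₀ t).apply l ξ
  have hle : ∀ ξ l, ‖ξ‖ ^ 0 * ‖V ξ l‖ ≤ (fun (_ : Fin 3) ξ => B₁ * ((1 + ‖ξ‖) ^ 2)⁻¹) l ξ := fun ξ l => by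
    rw [pow_zero, one_mul]; exact (hB₁ t).apply l ξ
  -- Plancherel twice
  have hP₀ := lintegral_levelSq_synthVel_eq_of_moments V₀ hmeas₀ hmom₀ hconj₀ 0 (fun _ => henv B₀) hle₀
  have hP := lintegral_levelSq_synthVel_eq_of_moments V hmeas hmom hconj 0 (fun _ => henv B₁) hle
  have hsyn₀ : synthVel V₀ = f (clamp T t) := synthVel_forceData hT hf hd t
  have hLHS : ∫⁻ x, ‖clayProjForce hT hf hd t x‖ₑ ^ 2 = ∫⁻ x, ENNReal.ofReal (levelSq 0 (synthVel V) x) := by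
    refine lintegral_congr fun x => ?_
    rw [levelSq_zero_eq_norm_sq, ← ofReal_norm, ← ENNReal.ofReal_pow (norm_nonneg _)]
    rfl
  have hRHS : ∫⁻ x, ‖f (clamp T t) x‖ₑ ^ 2 = ∫⁻ x, ENNReal.ofReal (levelSq 0 (synthVel V₀) x) := by
    refine lintegral_congr fun x => ?_
    rw [levelSq_zero_eq_norm_sq, ← ofReal_norm, ← ENNReal.ofReal_pow (norm_nonneg _), hsyn₀]
  rw [hLHS, hRHS, hP, hP₀]
  simp only [mul_zero, pow_zero, ENNReal.ofReal_one, one_mul]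
  -- pointwise on the Fourier side: `∑ₗ ‖(P b) ξ l‖ₑ² ≤ 48 ∑ₗ ‖b ξ l‖ₑ²`
  rw [← lintegral_const_mul' _ _ (by norm_num)]
  refine lintegral_mono fun ξ => ?_
  have hcomp : ∀ l, ‖V ξ l‖ₑ ^ 2 ≤ 16 * ‖V₀ ξ‖ₑ ^ 2 := by
    intro l
    have h1 : ‖V ξ l‖ ≤ (1 + Fintype.card (Fin 3)) * ‖V₀ ξ‖ := norm_lerayPart_apply_le _ ξ l
    rw [Fintype.card_fin] at h1
    norm_num at h1
    have h2 : ‖V ξ l‖ₑ ≤ 4 * ‖V₀ ξ‖ₑ := by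
      rw [← ofReal_norm, ← ofReal_norm, ← ENNReal.ofReal_ofNat, ← ENNReal.ofReal_mul (by norm_num)]
      exact ENNReal.ofReal_le_ofReal h1
    calc ‖V ξ l‖ₑ ^ 2 ≤ (4 * ‖V₀ ξ‖ₑ) ^ 2 := pow_le_pow_left' h2 2
      _ = 16 * ‖V₀ ξ‖ₑ ^ 2 := by ring
  calc ∑ l, ‖V ξ l‖ₑ ^ 2 ≤ ∑ _l : Fin 3, 16 * ‖V₀ ξ‖ₑ ^ 2 := Finset.sum_le_sum fun l _ => hcomp l
    _ = 48 * ‖V₀ ξ‖ₑ ^ 2 := by simp; ring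
    _ ≤ 48 * ∑ l, ‖V₀ ξ l‖ₑ ^ 2 := by gcongr; exact enorm_sq_le_sum_enorm_sq _

include hT hf hd in
/-- **`‖P f(t)‖_{L²} ≤ 4√3 · F₂` whenever `‖f(s)‖_{L²} ≤ F₂` on the slab** (the clamp sends every real
time into `[0, T]`). [cite: LemarieRieusset2016, §6.1] -/
theorem eLpNorm_two_clayProjForce_le {F₂ : ℝ}
    (hf2 : ∀ s ∈ Icc 0 T, eLpNorm (f s) 2 volume ≤ ENNReal.ofReal F₂) (t : ℝ) :
    eLpNorm (clayProjForce hT hf hd t) 2 volume ≤ ENNReal.ofReal (4 * Real.sqrt 3 * F₂) := by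
  have hcl : clamp T t ∈ Icc 0 T := clamp_mem_Icc hT.le t
  have h2 := hf2 _ hcl
  rw [eLpNorm_eq_lintegral_rpow_enorm_toReal two_ne_zero ENNReal.ofNat_ne_top, ENNReal.toReal_ofNat] at h2 ⊢
  simp only [one_div] at h2 ⊢
  have hsq : ∫⁻ x, ‖clayProjForce hT hf hd t x‖ₑ ^ (2 : ℝ) ≤ 48 * ∫⁻ x, ‖f (clamp T t) x‖ₑ ^ (2 : ℝ) := by
    have h := lintegral_enorm_sq_clayProjForce_le hT hf hd t
    simp_rw [← ENNReal.rpow_natCast] at h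
    exact_mod_cast h
  have h48 : (48 : ℝ≥0∞) = ENNReal.ofReal ((4 * Real.sqrt 3) ^ 2) := by
    rw [mul_pow, Real.sq_sqrt (by norm_num : (0:ℝ) ≤ 3)]; norm_num
  calc (∫⁻ x, ‖clayProjForce hT hf hd t x‖ₑ ^ (2 : ℝ)) ^ (2 : ℝ)⁻¹
      ≤ (48 * ∫⁻ x, ‖f (clamp T t) x‖ₑ ^ (2 : ℝ)) ^ (2 : ℝ)⁻¹ := ENNReal.rpow_le_rpow hsq (by norm_num)
    _ = ENNReal.ofReal (4 * Real.sqrt 3) * (∫⁻ x, ‖f (clamp T t) x‖ₑ ^ (2 : ℝ)) ^ (2 : ℝ)⁻¹ := by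
        rw [ENNReal.mul_rpow_of_nonneg _ _ (by norm_num), h48, ENNReal.ofReal_pow (by positivity),
          ← ENNReal.rpow_natCast, ← ENNReal.rpow_mul]
        norm_num
    _ ≤ ENNReal.ofReal (4 * Real.sqrt 3) * ENNReal.ofReal F₂ := by gcongr
    _ = ENNReal.ofReal (4 * Real.sqrt 3 * F₂) := by rw [← ENNReal.ofReal_mul (by positivity)]

end Projection

/-! ### §1 `L⁶`-continuity of bounded `L²`-continuous slices -/

section SixContinuity

variable {S : Set ℝ} {u : ℝ → EuclideanSpace ℝ (Fin 3) → EuclideanSpace ℝ (Fin 3)} {M : ℝ}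

/-- `‖w‖₆ ≤ (2M)^{2/3} ‖w‖₂^{1/3}` for a field bounded by `2M` (`∫|w|⁶ ≤ (2M)⁴ ∫|w|²`), in `ℝ≥0∞`. [folklore] -/
private theorem eLpNorm_six_le_of_norm_le {w : EuclideanSpace ℝ (Fin 3) → EuclideanSpace ℝ (Fin 3)} {B : ℝ}
    (hw : ∀ x, ‖w x‖ ≤ B) :
    eLpNorm w 6 volume ≤ ENNReal.ofReal B ^ (2 / 3 : ℝ) * (eLpNorm w 2 volume) ^ (1 / 3 : ℝ) := by
  rw [eLpNorm_eq_lintegral_rpow_enorm_toReal (by norm_num) (by norm_num),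
    eLpNorm_eq_lintegral_rpow_enorm_toReal two_ne_zero ENNReal.ofNat_ne_top]
  simp only [ENNReal.toReal_ofNat]
  have h6 : ∫⁻ x, ‖w x‖ₑ ^ (6 : ℝ) ≤ ENNReal.ofReal B ^ ((6 : ℝ) - 2) * ∫⁻ x, ‖w x‖ₑ ^ (2 : ℝ) := by
    rw [← lintegral_const_mul' _ _ (ENNReal.rpow_ne_top_of_nonneg (by norm_num) ENNReal.ofReal_ne_top)]
    refine lintegral_mono fun x => ?_
    have hsplit : ‖w x‖ₑ ^ (6 : ℝ) = ‖w x‖ₑ ^ ((6 : ℝ) - 2) * ‖w x‖ₑ ^ (2 : ℝ) := by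
      rw [← ENNReal.rpow_add_of_nonneg ((6 : ℝ) - 2) 2 (by norm_num) (by norm_num)]; norm_num
    rw [hsplit]
    gcongr
    rw [← ofReal_norm]
    exact ENNReal.ofReal_le_ofReal (hw x)
  calc (∫⁻ x, ‖w x‖ₑ ^ (6 : ℝ)) ^ (1 / 6 : ℝ)
      ≤ (ENNReal.ofReal B ^ ((6 : ℝ) - 2) * ∫⁻ x, ‖w x‖ₑ ^ (2 : ℝ)) ^ (1 / 6 : ℝ) :=
        ENNReal.rpow_le_rpow h6 (by norm_num)
    _ = ENNReal.ofReal B ^ (2 / 3 : ℝ) * ((∫⁻ x, ‖w x‖ₑ ^ (2 : ℝ)) ^ (1 / 2 : ℝ)) ^ (1 / 3 : ℝ) := by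
        rw [ENNReal.mul_rpow_of_nonneg _ _ (by norm_num), ← ENNReal.rpow_mul, ← ENNReal.rpow_mul]
        norm_num

/-- **Bounded `L²`-continuous slices are `L⁶`-continuous**: if `u ∈ C(S; L²)` and `|u| ≤ M` on
`S × ℝ³` with continuous slices, then `t ↦ ‖u(t)‖_{L⁶}` is continuous on `S` (interpolation
`‖w‖₆ ≤ (2M)^{2/3}‖w‖₂^{1/3}` applied to `w = u(t) - u(t₀)`). [folklore] -/
private theorem continuousOn_eLpNorm_six_of_continuousInLpOn_two (hc : ContinuousInLpOn S 2 u)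
    (hMb : ∀ t ∈ S, ∀ y, ‖u t y‖ ≤ M) (hsl : ∀ t ∈ S, Continuous (u t)) :
    ContinuousOn (fun t => eLpNorm (u t) 6 volume) S := by
  intro t₀ ht₀
  have hm : ∀ t ∈ S, AEStronglyMeasurable (u t) volume := fun t ht => (hsl t ht).aestronglyMeasurable
  -- the modulus `D t = (2M)^{2/3} ‖u t - u t₀‖₂^{1/3} → 0`
  set D : ℝ → ℝ≥0∞ := fun t => ENNReal.ofReal (2 * M) ^ (2 / 3 : ℝ) *
    (eLpNorm (u t - u t₀) 2 volume) ^ (1 / 3 : ℝ) with hD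
  have hD0 : Tendsto D (𝓝[S] t₀) (𝓝 0) := by
    have h1 : Tendsto (fun t => (eLpNorm (u t - u t₀) 2 volume) ^ (1 / 3 : ℝ)) (𝓝[S] t₀) (𝓝 0) := by
      have h := (hc.2 t₀ ht₀)
      have h0 : (0 : ℝ≥0∞) ^ (1 / 3 : ℝ) = 0 := ENNReal.zero_rpow_of_pos (by norm_num)
      rw [← h0]
      exact (ENNReal.continuous_rpow_const.tendsto 0).comp h
    have h2 := ENNReal.Tendsto.const_mul (a := ENNReal.ofReal (2 * M) ^ (2 / 3 : ℝ)) h1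
      (Or.inr (ENNReal.rpow_ne_top_of_nonneg (by norm_num : (0 : ℝ) ≤ 2 / 3) ENNReal.ofReal_ne_top))
    rw [mul_zero] at h2
    exact h2
  have hdiff : ∀ t ∈ S, eLpNorm (u t - u t₀) 6 volume ≤ D t := by
    intro t ht
    exact eLpNorm_six_le_of_norm_le fun x => by
      calc ‖(u t - u t₀) x‖ = ‖u t x - u t₀ x‖ := rfl
        _ ≤ ‖u t x‖ + ‖u t₀ x‖ := norm_sub_le _ _
        _ ≤ M + M := add_le_add (hMb t ht x) (hMb t₀ ht₀ x)
        _ = 2 * M := by ring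
  -- two-sided triangle inequality and squeeze
  have hup : ∀ t ∈ S, eLpNorm (u t) 6 volume ≤ eLpNorm (u t₀) 6 volume + D t := by
    intro t ht
    have h : u t = u t₀ + (u t - u t₀) := by abel
    calc eLpNorm (u t) 6 volume = eLpNorm (u t₀ + (u t - u t₀)) 6 volume := by rw [← h]
      _ ≤ eLpNorm (u t₀) 6 volume + eLpNorm (u t - u t₀) 6 volume :=
          eLpNorm_add_le (hm t₀ ht₀) ((hm t ht).sub (hm t₀ ht₀)) (by norm_num)
      _ ≤ eLpNorm (u t₀) 6 volume + D t := by gcongr; exact hdiff t ht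
  have hdown : ∀ t ∈ S, eLpNorm (u t₀) 6 volume ≤ eLpNorm (u t) 6 volume + D t := by
    intro t ht
    have h : u t₀ = u t - (u t - u t₀) := by abel
    calc eLpNorm (u t₀) 6 volume = eLpNorm (u t - (u t - u t₀)) 6 volume := by rw [← h]
      _ ≤ eLpNorm (u t) 6 volume + eLpNorm (u t - u t₀) 6 volume :=
          eLpNorm_sub_le (hm t ht) ((hm t ht).sub (hm t₀ ht₀)) (by norm_num)
      _ ≤ eLpNorm (u t) 6 volume + D t := by gcongr; exact hdiff t ht
  -- squeeze in `ℝ≥0∞`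
  have hupT : Tendsto (fun t => eLpNorm (u t₀) 6 volume + D t) (𝓝[S] t₀) (𝓝 (eLpNorm (u t₀) 6 volume)) := by
    have h := hD0.const_add (eLpNorm (u t₀) 6 volume)
    rwa [add_zero] at h
  refine tendsto_order.2 ⟨fun b hb => ?_, fun b hb => ?_⟩
  · -- lower: eventually `b < ‖u t‖₆`, from `‖u t₀‖₆ ≤ ‖u t‖₆ + D t` and `D t → 0`
    have hgap : 0 < eLpNorm (u t₀) 6 volume - b := tsub_pos_of_lt hb
    have hDsmall : ∀ᶠ t in 𝓝[S] t₀, D t < eLpNorm (u t₀) 6 volume - b :=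
      hD0 (Iio_mem_nhds hgap)
    filter_upwards [hDsmall, self_mem_nhdsWithin] with t hDt htS
    have h1 := hdown t htS
    by_contra hle
    push Not at hle
    have : eLpNorm (u t₀) 6 volume ≤ b + D t := h1.trans (add_le_add hle le_rfl)
    have hb_top : b ≠ ⊤ := ne_top_of_lt hb
    have : eLpNorm (u t₀) 6 volume - b ≤ D t := by
      exact tsub_le_iff_left.2 this
    exact absurd hDt (not_lt.2 this)
  · -- upper: eventually `‖u t‖₆ < b`
    have hev : ∀ᶠ t in 𝓝[S] t₀, eLpNorm (u t₀) 6 volume + D t < b := (tendsto_order.1 hupT).2 b hb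
    filter_upwards [hev, self_mem_nhdsWithin] with t ht htS
    exact (hup t htS).trans_lt ht

end SixContinuity

/-! ### §2 No enstrophy blow-up under a sup bound: the explicit (solution-uniform) form -/

section Enstrophy

variable {ν : ℝ}

/-- `‖D⁰g‖ = ‖g‖` under the integral sign. [folklore] -/
private theorem lintegral_iteratedFDeriv_zero_eq' {F : Type*} [NormedAddCommGroup F] [NormedSpace ℝ F]
    (g : EuclideanSpace ℝ (Fin 3) → F) :
    ∫⁻ x, ‖iteratedFDeriv ℝ 0 g x‖ₑ ^ 2 = ∫⁻ x, ‖g x‖ₑ ^ 2 :=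
  lintegral_congr fun x => by rw [← ofReal_norm, norm_iteratedFDeriv_zero, ofReal_norm]

/-- The `H¹` packaging: `L²` bounds of orders `0` and `1` give `∫|g|² + ∫|∇g|²_F ≤ (√(G₀ + 3G₁))²`.
[folklore] -/
private theorem H1_pack' {g : EuclideanSpace ℝ (Fin 3) → EuclideanSpace ℝ (Fin 3)} {G₀ G₁ : ℝ≥0}
    (h0 : ∫⁻ x, ‖iteratedFDeriv ℝ 0 g x‖ₑ ^ 2 ≤ G₀) (h1 : ∫⁻ x, ‖iteratedFDeriv ℝ 1 g x‖ₑ ^ 2 ≤ G₁) :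
    (∫⁻ x, ‖g x‖ₑ ^ 2) + (∫⁻ x, ENNReal.ofReal (frobeniusNormSq (fderiv ℝ g x))) ≤
      ENNReal.ofReal ((Real.sqrt (G₀ + 3 * G₁)) ^ 2) := by
  rw [Real.sq_sqrt (by positivity), ENNReal.ofReal_add (by positivity) (by positivity),
    ENNReal.ofReal_coe_nnreal, ENNReal.ofReal_mul (by norm_num), ENNReal.ofReal_coe_nnreal,
    show ENNReal.ofReal (3 : ℝ) = 3 by norm_num]
  refine add_le_add (by rwa [← lintegral_iteratedFDeriv_zero_eq']) ?_
  calc ∫⁻ x, ENNReal.ofReal (frobeniusNormSq (fderiv ℝ g x))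
      ≤ ∫⁻ x, 3 * ‖iteratedFDeriv ℝ 1 g x‖ₑ ^ 2 := lintegral_mono fun x => by
        rw [← ofReal_norm, norm_iteratedFDeriv_one, ofReal_norm]
        exact ofReal_frobeniusNormSq_le_three_mul_enorm_sq _
    _ = 3 * ∫⁻ x, ‖iteratedFDeriv ℝ 1 g x‖ₑ ^ 2 := lintegral_const_mul' _ _ (by norm_num)
    _ ≤ 3 * G₁ := by gcongr

/-- **One uniform step.** For `A, B ≥ 0`, `c, ν, T > 0` there are `h > 0` and `N ≥ 1` with
`T = N h` and Tao's smallness `(A + Bh)⁴ h ≤ c ν³`. [cite: Tao2011, Thm. 5.4 (ii) (arXiv Thm. 31)] -/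
private theorem exists_uniform_step' {A B c T : ℝ} (hA : 0 ≤ A) (hB : 0 ≤ B) (hc : 0 < c)
    (hν : 0 < ν) (hT : 0 < T) :
    ∃ h : ℝ, 0 < h ∧ ∃ N : ℕ, 0 < N ∧ T = N * h ∧ (A + B * h) ^ 4 * h ≤ c * ν ^ 3 := by
  set D : ℝ := (A + B + 1) ^ 4 with hD
  have hDpos : 0 < D := by positivity
  set h₀ : ℝ := min 1 (c * ν ^ 3 / D) with hh₀
  have hh₀pos : 0 < h₀ := lt_min one_pos (div_pos (by positivity) hDpos)
  have hh₀1 : h₀ ≤ 1 := min_le_left _ _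
  have hh₀D : D * h₀ ≤ c * ν ^ 3 := by
    have : h₀ ≤ c * ν ^ 3 / D := min_le_right _ _
    rwa [le_div_iff₀ hDpos, mul_comm] at this
  set N : ℕ := ⌈T / h₀⌉₊ with hN
  have hTN : T / h₀ ≤ N := Nat.le_ceil _
  have hNpos' : (0 : ℝ) < N := lt_of_lt_of_le (div_pos hT hh₀pos) hTN
  have hNpos : 0 < N := by exact_mod_cast hNpos'
  set h : ℝ := T / N with hh
  have hhpos : 0 < h := div_pos hT hNpos'
  have hhh₀ : h ≤ h₀ := by
    rw [hh, div_le_iff₀ hNpos']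
    have := mul_le_mul_of_nonneg_left hTN hh₀pos.le
    rw [mul_div_cancel₀ _ hh₀pos.ne'] at this
    linarith [mul_comm h₀ (N : ℝ)]
  refine ⟨h, hhpos, N, hNpos, by rw [hh, mul_div_cancel₀ _ hNpos'.ne'], ?_⟩
  have h1 : A + B * h ≤ A + B + 1 := by nlinarith [hhh₀.trans hh₀1]
  calc (A + B * h) ^ 4 * h ≤ D * h := by
        rw [hD]
        exact mul_le_mul_of_nonneg_right (pow_le_pow_left₀ (by positivity) h1 4) hhpos.le
    _ ≤ D * h₀ := by gcongr
    _ ≤ c * ν ^ 3 := hh₀D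

/-- The chaining inequality `e₂ (e₁ (a + b) + c) ≤ (e₂ e₁) (a + (b + c))` for `e₁ ≥ 1`. [folklore] -/
private theorem chain_le' {e₁ e₂ a b c : ℝ≥0∞} (he₁ : 1 ≤ e₁) :
    e₂ * (e₁ * (a + b) + c) ≤ e₂ * e₁ * (a + (b + c)) := by
  have hc : c ≤ e₁ * c := by
    calc c = 1 * c := (one_mul c).symm
      _ ≤ e₁ * c := by gcongr
  calc e₂ * (e₁ * (a + b) + c) ≤ e₂ * (e₁ * (a + b) + e₁ * c) := by gcongr
    _ = e₂ * e₁ * (a + (b + c)) := by ring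

/-- **No enstrophy blow-up while the velocity stays bounded — explicit, solution-uniform form.** For
`ν > 0` there is a rate `κ = κ(ν) ≥ 0` such that: for every classical solution `(u, p)` of the forced
Navier–Stokes system on a closed slab `[0, S] × ℝ³` with Tao-class velocity, Clay-class force `f` with
`sup_{t ≥ 0} ‖f(t)‖²₂ ≤ F₀`, and `|u| ≤ K` on the slab,
`∫|∇u(t)|² ≤ e^{κK²t} (∫|∇u(0)|² + ν⁻¹ F₀ t)` for all `t ∈ [0, S]` — Lemarié-Rieusset 2016, Thm. 11.2,
second clause at `(p, q) = (2, ∞)`; this is the bound INSIDE the tree's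
`ForcedEnstrophyOfSupNorm.exists_enstrophy_le_of_norm_le_forced` (pieces `exists_piece_rate` chained
along a uniform partition), stated with its dependence on `K`, `F₀` and `∫|∇u(0)|²` explicit, so that it
is uniform over a family of solutions with common datum and sup bound. [cite: LemarieRieusset2016, Thm. 11.2 (11.11)]
[cite: Tao2011, Thm. 5.4 (ii)+(iv) (arXiv Thm. 31)] -/
theorem enstrophy_le_exp_of_norm_le_forced (hν : 0 < ν) :
    ∃ κ : ℝ, 0 ≤ κ ∧ ∀ ⦃S : ℝ⦄ ⦃f u : ℝ → EuclideanSpace ℝ (Fin 3) → EuclideanSpace ℝ (Fin 3)⦄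
      ⦃p : ℝ → EuclideanSpace ℝ (Fin 3) → ℝ⦄, 0 < S →
      IsClassicalNSSolutionOn (Icc 0 S) ν f u p → HasBoundedSobolevNormsOn (Icc 0 S) u →
      IsSmoothOnHalfSpace f → HasRapidSpaceTimeDecay f →
      ∀ ⦃K : ℝ⦄, 0 ≤ K → (∀ t ∈ Icc 0 S, ∀ x, ‖u t x‖ ≤ K) →
      ∀ ⦃F₀ : ℝ≥0⦄, (∀ t, 0 ≤ t → ∫⁻ x, ‖iteratedFDeriv ℝ 0 (f t) x‖ₑ ^ 2 ≤ F₀) →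
      ∀ t ∈ Icc 0 S,
        ∫⁻ x, ENNReal.ofReal (frobeniusNormSq (fderiv ℝ (u t) x)) ≤
          ENNReal.ofReal (Real.exp (κ * (K ^ 2 * t))) *
            ((∫⁻ x, ENNReal.ofReal (frobeniusNormSq (fderiv ℝ (u 0) x))) +
              (ENNReal.ofReal ν)⁻¹ * ((F₀ : ℝ≥0∞) * ENNReal.ofReal t)) := by
  obtain ⟨c, hc, hloc⟩ := tao2011_smooth_local_existence_forced_holds
  obtain ⟨κ, hκ0, hpiece⟩ := ForcedEnstrophyOfSupNorm.exists_piece_rate hν hloc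
  refine ⟨κ, hκ0, ?_⟩
  intro S f u p hS hsol hub hfs hfd K hK0 hK F₀ hF₀ t ht
  -- force constants
  obtain ⟨F₁, hF₁⟩ := hfd.exists_lintegral_iteratedFDeriv_slice_sq_le_all (μ := volume) hfs 1
  set Bf : ℝ := Real.sqrt (F₀ + 3 * F₁) with hBfdef
  have hBf0 : 0 ≤ Bf := Real.sqrt_nonneg _
  have hBf : ∀ t, 0 ≤ t → (∫⁻ x, ‖f t x‖ₑ ^ 2) +
      (∫⁻ x, ENNReal.ofReal (frobeniusNormSq (fderiv ℝ (f t) x))) ≤ ENNReal.ofReal (Bf ^ 2) :=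
    fun t ht => H1_pack' (hF₀ t ht) (hF₁ t ht)
  -- the slab `H¹` bound of `u` (only fixes the partition)
  obtain ⟨C₀, hC₀⟩ := hub 0
  obtain ⟨C₁, hC₁⟩ := hub 1
  set A : ℝ := Real.sqrt (C₀ + 3 * C₁) with hAdef
  have hA : 0 ≤ A := Real.sqrt_nonneg _
  have hAu : ∀ τ ∈ Icc 0 S, (∫⁻ x, ‖u τ x‖ₑ ^ 2) +
      (∫⁻ x, ENNReal.ofReal (frobeniusNormSq (fderiv ℝ (u τ) x))) ≤ ENNReal.ofReal (A ^ 2) :=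
    fun τ hτ => H1_pack' (hC₀ τ hτ) (hC₁ τ hτ)
  -- the enstrophy and its majorant
  set E : ℝ → ℝ≥0∞ := fun t => ∫⁻ x, ENNReal.ofReal (frobeniusNormSq (fderiv ℝ (u t) x)) with hEdef
  set Φ : ℝ → ℝ≥0∞ := fun s => ENNReal.ofReal (Real.exp (κ * (K ^ 2 * s))) *
    (E 0 + (ENNReal.ofReal ν)⁻¹ * ((F₀ : ℝ≥0∞) * ENNReal.ofReal s)) with hΦdef
  have hΦ0 : E 0 ≤ Φ 0 := by
    simp only [hΦdef, mul_zero, Real.exp_zero, ENNReal.ofReal_one, one_mul, ENNReal.ofReal_zero,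
      add_zero]
    exact le_rfl
  show E t ≤ Φ t
  rcases ht.1.eq_or_lt with h0 | ht0
  · rw [← h0]; exact hΦ0
  obtain ⟨h, hh, N, -, htN, hsmall⟩ := exists_uniform_step' hA hBf0 hc hν ht0
  -- induction along the pieces `[kh, (k+1)h] ⊆ [0, t] ⊆ [0, S]`
  have hind : ∀ k : ℕ, (k : ℝ) * h ≤ t → ∀ s ∈ Icc 0 ((k : ℝ) * h), E s ≤ Φ s := by
    intro k
    induction k with
    | zero =>
      intro _ s hs
      have hs0 : s = 0 := le_antisymm (by simpa using hs.2) hs.1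
      rw [hs0]; exact hΦ0
    | succ k ih =>
      intro hk s hs
      push_cast at hk hs
      have hτ0 : 0 ≤ (k : ℝ) * h := by positivity
      have hkh : (k : ℝ) * h ≤ t := by nlinarith
      by_cases hsk : s ≤ k * h
      · exact ih hkh s ⟨hs.1, hsk⟩
      push Not at hsk
      have hτh : (k : ℝ) * h + h ≤ S := by linarith [ht.2]
      have hσ : s - k * h ∈ Ioc 0 h := ⟨by linarith, by linarith [hs.2]⟩
      have hP := hpiece hsol hub hfs hfd hK0 hK hF₀ hF₁ hA hBf0 hAu hBf hh hsmall hτ0 hτh hσ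
      rw [add_sub_cancel] at hP
      have hIH : E (k * h) ≤ Φ (k * h) := ih hkh (k * h) ⟨hτ0, le_rfl⟩
      calc E s ≤ ENNReal.ofReal (Real.exp (κ * (K ^ 2 * (s - k * h)))) *
            (E (k * h) + (ENNReal.ofReal ν)⁻¹ * ((F₀ : ℝ≥0∞) * ENNReal.ofReal (s - k * h))) := hP
        _ ≤ ENNReal.ofReal (Real.exp (κ * (K ^ 2 * (s - k * h)))) *
            (Φ (k * h) + (ENNReal.ofReal ν)⁻¹ * ((F₀ : ℝ≥0∞) * ENNReal.ofReal (s - k * h))) := by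
          gcongr
        _ ≤ Φ s := by
          simp only [hΦdef]
          refine (chain_le' (ENNReal.one_le_ofReal.2 (Real.one_le_exp (by positivity)))).trans
            (le_of_eq ?_)
          have hF : (ENNReal.ofReal ν)⁻¹ * ((F₀ : ℝ≥0∞) * ENNReal.ofReal (k * h)) +
              (ENNReal.ofReal ν)⁻¹ * ((F₀ : ℝ≥0∞) * ENNReal.ofReal (s - k * h)) =
              (ENNReal.ofReal ν)⁻¹ * ((F₀ : ℝ≥0∞) * ENNReal.ofReal s) := by
            rw [← mul_add, ← mul_add, ← ENNReal.ofReal_add hτ0 hσ.1.le, add_sub_cancel]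
          rw [← ENNReal.ofReal_mul (Real.exp_nonneg _), ← Real.exp_add, hF,
            show κ * (K ^ 2 * (s - k * h)) + κ * (K ^ 2 * (k * h)) = κ * (K ^ 2 * s) by ring]
  exact hind N (by rw [htN]) t ⟨ht.1, by rw [← htN]⟩

end Enstrophy

/-! ### §3 The a-priori sup bound for a Tao-class solution driven by a raw Clay force -/

section Apriori

variable {ν : ℝ}

/-- **`L²` size of the slices of a bounded confined force**: if `|g(t, x)| ≤ M` and `g(t, ·)` vanishes
off `B̄(0, R)`, then `‖g(t)‖_{L²} ≤ 3 M R^{3/2}` (`|B̄(0,R)| = 4πR³/3 ≤ 9R³`). [folklore] -/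
private theorem eLpNorm_two_le_of_confined {g : EuclideanSpace ℝ (Fin 3) → EuclideanSpace ℝ (Fin 3)}
    (hgc : Continuous g) {R M : ℝ} (hR : 0 ≤ R) (hM : 0 ≤ M) (hfar : ∀ x, R < ‖x‖ → g x = 0)
    (hbd : ∀ x, ‖g x‖ ≤ M) :
    eLpNorm g 2 volume ≤ ENNReal.ofReal (3 * M * R ^ (3 / 2 : ℝ)) := by
  set B : Set (EuclideanSpace ℝ (Fin 3)) := Metric.closedBall 0 R with hB
  have hpt : ∀ x, ‖g x‖ₑ ^ (2 : ℝ) ≤ B.indicator (fun _ => ENNReal.ofReal (M ^ 2)) x := by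
    intro x
    by_cases hx : x ∈ B
    · rw [indicator_of_mem hx, ← ofReal_norm,
        ENNReal.ofReal_rpow_of_nonneg (norm_nonneg _) (by norm_num : (0 : ℝ) ≤ 2), Real.rpow_two]
      exact ENNReal.ofReal_le_ofReal (pow_le_pow_left₀ (norm_nonneg _) (hbd x) 2)
    · have hx' : R < ‖x‖ := by
        rw [hB, Metric.mem_closedBall, dist_zero_right, not_le] at hx; exact hx
      rw [hfar x hx', indicator_of_notMem hx]
      simp
  have hsq : ∫⁻ x, ‖g x‖ₑ ^ (2 : ℝ) ≤ ENNReal.ofReal ((3 * M * R ^ (3 / 2 : ℝ)) ^ 2) := by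
    calc ∫⁻ x, ‖g x‖ₑ ^ (2 : ℝ) ≤ ∫⁻ x, B.indicator (fun _ => ENNReal.ofReal (M ^ 2)) x := lintegral_mono hpt
      _ = ENNReal.ofReal (M ^ 2) * volume B := lintegral_indicator_const Metric.isClosed_closedBall.measurableSet _
      _ = ENNReal.ofReal (M ^ 2 * (R ^ 3 * (Real.pi * 4 / 3))) := by
          rw [hB, EuclideanSpace.volume_closedBall_fin_three, ← ENNReal.ofReal_pow hR,
            ← ENNReal.ofReal_mul (by positivity), ← ENNReal.ofReal_mul (by positivity)]
      _ ≤ ENNReal.ofReal ((3 * M * R ^ (3 / 2 : ℝ)) ^ 2) := by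
          refine ENNReal.ofReal_le_ofReal ?_
          have hR3 : (R ^ (3 / 2 : ℝ)) ^ 2 = R ^ 3 := by
            rw [← Real.rpow_natCast, ← Real.rpow_mul hR]; norm_num
          have hπ : Real.pi * 4 / 3 ≤ 9 := by linarith [Real.pi_lt_four]
          calc M ^ 2 * (R ^ 3 * (Real.pi * 4 / 3)) ≤ M ^ 2 * (R ^ 3 * 9) := by
                gcongr
            _ = (3 * M * R ^ (3 / 2 : ℝ)) ^ 2 := by rw [mul_pow, mul_pow, hR3]; ring
  rw [eLpNorm_eq_lintegral_rpow_enorm_toReal two_ne_zero ENNReal.ofNat_ne_top, ENNReal.toReal_ofNat]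
  have _ := hgc
  calc (∫⁻ x, ‖g x‖ₑ ^ (2 : ℝ)) ^ (1 / (2 : ℝ))
      ≤ (ENNReal.ofReal ((3 * M * R ^ (3 / 2 : ℝ)) ^ 2)) ^ (1 / (2 : ℝ)) := ENNReal.rpow_le_rpow hsq (by norm_num)
    _ = ENNReal.ofReal (3 * M * R ^ (3 / 2 : ℝ)) := by
        rw [ENNReal.ofReal_pow (by positivity), ← ENNReal.rpow_natCast, ← ENNReal.rpow_mul]
        norm_num

/-- **The a-priori sup bound for a Tao-class classical solution driven by a raw Clay-class force.**
Given the constants `ε₀, K` of `KatoAprioriForced.kato_apriori_forced` (hypothesis `hAK`), a classical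
solution `(u, p)` on `[0, S] × ℝ³` with Tao-class, `L²`-continuous velocity, driven by a force `f`
smooth on the closed half-space with Fefferman decay and `‖f(t)‖₂ ≤ F₂` on `[0, S]`, with
`δ_A := ‖u(0)‖₃/ν + S^{3/4}(4√3 F₂)/ν^{5/4} ≤ ε₀`, satisfies `|u(t, x)| ≤ K δ_A ν^{1/2} t^{-1/2}` on
`(0, S] × ℝ³` — the momentum equation is re-gauged to the projected force `P f`
(`IsClassicalNSSolutionOn.to_clayProjForce`), which has continuous, bounded, weakly divergence-free
slices of `L²` size `≤ 4√3 F₂`. [cite: Kato1984, Thm. 2 with (2.3)–(2.5)] [cite: Tao2011, (8) p. 3] -/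
theorem norm_le_of_taoClass (hν : 0 < ν) {ε₀ K : ℝ}
    (hAK : ∀ ⦃ν T M G G₂ : ℝ⦄ ⦃g u : ℝ → EuclideanSpace ℝ (Fin 3) → EuclideanSpace ℝ (Fin 3)⦄
        ⦃p : ℝ → EuclideanSpace ℝ (Fin 3) → ℝ⦄,
      0 < ν → 0 < T →
      IsClassicalNSSolutionOn (Icc 0 T) ν g u p → Continuous (uncurry g) →
      (∀ τ ∈ Icc 0 T, ∀ y, ‖g τ y‖ ≤ G) → (∀ τ ∈ Icc 0 T, IsWeaklyDivFree (g τ)) →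
      0 ≤ G₂ → (∀ τ ∈ Icc 0 T, eLpNorm (g τ) 2 volume ≤ ENNReal.ofReal G₂) →
      (∃ C : ℝ≥0∞, C < ⊤ ∧ ∀ t ∈ Icc 0 T, ∫⁻ x, ‖u t x‖ₑ ^ 2 ≤ C) →
      0 < M → (∀ t ∈ Icc 0 T, ∀ y, ‖u t y‖ ≤ M) →
      ContinuousOn (fun t => eLpNorm (u t) 6 volume) (Icc 0 T) →
      (eLpNorm (u 0) 3 volume).toReal / ν + T ^ (3 / 4 : ℝ) * G₂ / ν ^ (5 / 4 : ℝ) ≤ ε₀ →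
      ∀ t ∈ Ioc 0 T,
        eLpNorm (u t) 6 volume ≤ ENNReal.ofReal (K *
          ((eLpNorm (u 0) 3 volume).toReal / ν + T ^ (3 / 4 : ℝ) * G₂ / ν ^ (5 / 4 : ℝ)) *
            ν ^ (3 / 4 : ℝ) * t ^ (-(1 / 4 : ℝ))) ∧
        ∀ x, ‖u t x‖ ≤ K *
          ((eLpNorm (u 0) 3 volume).toReal / ν + T ^ (3 / 4 : ℝ) * G₂ / ν ^ (5 / 4 : ℝ)) *
            ν ^ (1 / 2 : ℝ) * t ^ (-(1 / 2 : ℝ)))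
    {S : ℝ} (hS : 0 < S) {f u : ℝ → EuclideanSpace ℝ (Fin 3) → EuclideanSpace ℝ (Fin 3)}
    {p : ℝ → EuclideanSpace ℝ (Fin 3) → ℝ}
    (hsol : IsClassicalNSSolutionOn (Icc 0 S) ν f u p) (hub : HasBoundedSobolevNormsOn (Icc 0 S) u)
    (hc2 : ContinuousInLpOn (Icc 0 S) 2 u)
    (hfs : IsSmoothOnHalfSpace f) (hfd : HasRapidSpaceTimeDecay f) {F₂ : ℝ} (hF₂ : 0 ≤ F₂)
    (hf2 : ∀ t ∈ Icc 0 S, eLpNorm (f t) 2 volume ≤ ENNReal.ofReal F₂)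
    (hsmall : (eLpNorm (u 0) 3 volume).toReal / ν + S ^ (3 / 4 : ℝ) * (4 * Real.sqrt 3 * F₂) / ν ^ (5 / 4 : ℝ) ≤ ε₀)
    {t : ℝ} (ht : t ∈ Ioc 0 S) (x : EuclideanSpace ℝ (Fin 3)) :
    ‖u t x‖ ≤ K * ((eLpNorm (u 0) 3 volume).toReal / ν +
      S ^ (3 / 4 : ℝ) * (4 * Real.sqrt 3 * F₂) / ν ^ (5 / 4 : ℝ)) * ν ^ (1 / 2 : ℝ) * t ^ (-(1 / 2 : ℝ)) := by
  -- the force on the slab and its Leray projection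
  have hfS : IsSmoothSpaceTimeOn (Icc 0 S) f := hfs.isSmoothSpaceTimeOn_Icc S
  have hfD : HasUniformRapidDecayOn (Icc 0 S) f := hfd.hasUniformRapidDecayOn_Icc hfs hS
  have hcl := hsol.to_clayProjForce hS hfS hfD
  have hgc := continuous_uncurry_clayProjForce hS hfS hfD
  obtain ⟨G, -, hG⟩ := exists_norm_clayProjForce_le hS hfS hfD
  have hgdiv := isWeaklyDivFree_clayProjForce hS hfS hfD
  have hg2 : ∀ τ ∈ Icc 0 S, eLpNorm (clayProjForce hS hfS hfD τ) 2 volume ≤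
      ENNReal.ofReal (4 * Real.sqrt 3 * F₂) := fun τ _ => eLpNorm_two_clayProjForce_le hS hfS hfD hf2 τ
  -- energy, sup bound and `L⁶`-continuity of the Tao-class velocity
  have hE : ∃ C : ℝ≥0∞, C < ⊤ ∧ ∀ t ∈ Icc 0 S, ∫⁻ x, ‖u t x‖ₑ ^ 2 ≤ C := by
    obtain ⟨C₀, hC₀⟩ := hub 0
    refine ⟨C₀, ENNReal.coe_lt_top, fun t ht => ?_⟩
    rw [← lintegral_iteratedFDeriv_zero_eq']
    exact hC₀ t ht
  obtain ⟨Cb, hCb⟩ := linfty_bound_of_hasBoundedSobolevNormsOn_holds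
    (fun t ht => (hsol.contDiff_velocity ht).of_le (by norm_cast)) hub
  set M : ℝ := max Cb 1 with hM
  have hM0 : 0 < M := lt_of_lt_of_le one_pos (le_max_right _ _)
  have hMb : ∀ t ∈ Icc 0 S, ∀ y, ‖u t y‖ ≤ M := fun t ht y => (hCb t ht y).trans (le_max_left _ _)
  have h6c := continuousOn_eLpNorm_six_of_continuousInLpOn_two hc2 hMb
    fun t ht => (hsol.contDiff_velocity ht).continuous
  exact (hAK hν hS hcl hgc (fun τ _ y => hG τ y) (fun τ _ => hgdiv τ) (by positivity) hg2 hE hM0 hMb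
    h6c hsmall t ht).2 x

end Apriori

/-! ### §4 Existence on the full slab by uniform-step continuation -/

section Existence

variable {ν : ℝ}

/-- `(∫ ‖g‖²)^{1/2} = ‖g‖_{L²}` (exponent bookkeeping `ℕ`-power vs `rpow`). [folklore] -/
private theorem lintegral_sq_rpow_half_eq_eLpNorm {F : Type*} [NormedAddCommGroup F]
    (g : EuclideanSpace ℝ (Fin 3) → F) :
    (∫⁻ x, ‖g x‖ₑ ^ 2) ^ (1 / 2 : ℝ) = eLpNorm g 2 volume := by
  rw [eLpNorm_eq_lintegral_rpow_enorm_toReal two_ne_zero ENNReal.ofNat_ne_top, ENNReal.toReal_ofNat]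
  congr 1
  refine lintegral_congr fun x => ?_
  rw [← ENNReal.rpow_natCast]; norm_num

/-- All `L²` Sobolev norms of a smooth compactly supported field are finite. [folklore] -/
private theorem lintegral_iteratedFDeriv_lt_top_of_hasCompactSupport
    {u₀ : EuclideanSpace ℝ (Fin 3) → EuclideanSpace ℝ (Fin 3)} (hu₀ : ContDiff ℝ ∞ u₀)
    (hc : HasCompactSupport u₀) (n : ℕ) : ∫⁻ x, ‖iteratedFDeriv ℝ n u₀ x‖ₑ ^ 2 < ⊤ := by
  have hcont : Continuous (iteratedFDeriv ℝ n u₀) :=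
    hu₀.continuous_iteratedFDeriv (by exact_mod_cast le_top)
  have hmem : MemLp (iteratedFDeriv ℝ n u₀) 2 volume :=
    hcont.memLp_of_hasCompactSupport (hc.iteratedFDeriv n)
  have h := lintegral_rpow_enorm_lt_top_of_eLpNorm_lt_top two_ne_zero ENNReal.ofNat_ne_top hmem.eLpNorm_lt_top
  rw [ENNReal.toReal_ofNat] at h
  refine lt_of_le_of_lt (le_of_eq (lintegral_congr fun x => ?_)) h
  rw [← ENNReal.rpow_natCast]; norm_num

/-- **The first package**: Tao's forced smooth existence (`smooth_existence_forced_fullSlab` with the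
discharged `tao2011_smooth_local_existence_forced_holds`) from a smooth compactly supported
divergence-free datum and a Clay-class force gives a Tao-class classical solution on SOME closed slab
`[0, h₁]`, `0 < h₁ ≤ W`. [cite: Tao2011, Thm. 5.4 (ii)+(iv) (arXiv Thm. 31)] -/
theorem exists_first_taoClass (hν : 0 < ν) {W : ℝ} (hW : 0 < W)
    {u₀ : EuclideanSpace ℝ (Fin 3) → EuclideanSpace ℝ (Fin 3)} (hu₀ : ContDiff ℝ ∞ u₀)
    (hu₀c : HasCompactSupport u₀) (hdiv : VectorCalculus.IsDivFree u₀)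
    {f : ℝ → EuclideanSpace ℝ (Fin 3) → EuclideanSpace ℝ (Fin 3)}
    (hfs : IsSmoothOnHalfSpace f) (hfd : HasRapidSpaceTimeDecay f) :
    ∃ h₁ : ℝ, 0 < h₁ ∧ h₁ ≤ W ∧
      ∃ (u : ℝ → EuclideanSpace ℝ (Fin 3) → EuclideanSpace ℝ (Fin 3))
        (p : ℝ → EuclideanSpace ℝ (Fin 3) → ℝ),
        IsClassicalNSSolutionOn (Icc 0 h₁) ν f u p ∧ u 0 = u₀ ∧
        HasBoundedSobolevNormsOn (Icc 0 h₁) u ∧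
        HasBoundedSobolevNormsOn (Icc 0 h₁) (timeDerivWithin (Icc 0 h₁) u) ∧
        (∀ n : ℕ, ∃ C : ℝ≥0, ∀ t ∈ Icc 0 h₁, ∫⁻ x, ‖iteratedFDeriv ℝ n (p t) x‖ₑ ^ 2 ≤ C) ∧
        ContinuousInLpOn (Icc 0 h₁) 2 u := by
  obtain ⟨c, hc, hP5⟩ := smooth_existence_forced_fullSlab tao2011_smooth_local_existence_forced_holds
  have hH : ∀ n : ℕ, ∫⁻ x, ‖iteratedFDeriv ℝ n u₀ x‖ₑ ^ 2 < ⊤ :=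
    lintegral_iteratedFDeriv_lt_top_of_hasCompactSupport hu₀ hu₀c
  -- the `H¹` size of the datum
  set A₀ : ℝ≥0∞ := (∫⁻ x, ‖u₀ x‖ₑ ^ 2) + ∫⁻ x, ENNReal.ofReal (frobeniusNormSq (fderiv ℝ u₀ x)) with hA₀
  have hA₀top : A₀ < ⊤ := by
    have h0 : ∫⁻ x, ‖u₀ x‖ₑ ^ 2 < ⊤ := by
      rw [← lintegral_iteratedFDeriv_zero_eq']; exact hH 0
    have h1 : ∫⁻ x, ENNReal.ofReal (frobeniusNormSq (fderiv ℝ u₀ x)) < ⊤ := by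
      calc ∫⁻ x, ENNReal.ofReal (frobeniusNormSq (fderiv ℝ u₀ x))
          ≤ ∫⁻ x, 3 * ‖iteratedFDeriv ℝ 1 u₀ x‖ₑ ^ 2 := lintegral_mono fun x => by
            rw [← ofReal_norm, norm_iteratedFDeriv_one, ofReal_norm]
            exact ofReal_frobeniusNormSq_le_three_mul_enorm_sq _
        _ = 3 * ∫⁻ x, ‖iteratedFDeriv ℝ 1 u₀ x‖ₑ ^ 2 := lintegral_const_mul' _ _ (by norm_num)
        _ < ⊤ := ENNReal.mul_lt_top (by norm_num) (hH 1)
    exact ENNReal.add_lt_top.2 ⟨h0, h1⟩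
  set A : ℝ := A₀.toReal with hAdef
  have hA : 0 ≤ A := ENNReal.toReal_nonneg
  have hAle : A₀ ≤ ENNReal.ofReal A := by rw [hAdef, ENNReal.ofReal_toReal hA₀top.ne]
  -- the force budget
  obtain ⟨Bf, hBf0, hBf⟩ := clayForce_lintegral_sqrt_eH1NormSq_translate_le hfs hfd W
  -- the first lifespan
  set D : ℝ := (Real.sqrt A + Bf + 1) ^ 4 with hD
  have hDpos : 0 < D := by positivity
  set h₁ : ℝ := min W (c * ν ^ 3 / D) with hh₁
  have hh₁pos : 0 < h₁ := lt_min hW (div_pos (by positivity) hDpos)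
  have hh₁W : h₁ ≤ W := min_le_left _ _
  have hsmall : (Real.sqrt A + Bf) ^ 4 * h₁ ≤ c * ν ^ 3 := by
    have h1 : (Real.sqrt A + Bf) ^ 4 ≤ D :=
      pow_le_pow_left₀ (by positivity) (by linarith) 4
    have h2 : D * h₁ ≤ c * ν ^ 3 := by
      have : h₁ ≤ c * ν ^ 3 / D := min_le_right _ _
      rwa [le_div_iff₀ hDpos, mul_comm] at this
    nlinarith [mul_le_mul_of_nonneg_right h1 hh₁pos.le]
  have hBf₁ : ∫⁻ t in Ioo 0 h₁, eH1NormSq (f t) ^ (2⁻¹ : ℝ) ≤ ENNReal.ofReal Bf := by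
    have h := hBf 0 le_rfl h₁ hh₁W
    simpa only [add_zero] using h
  obtain ⟨u, p, hsol, h0, hub, hdt, hq, hc2⟩ :=
    hP5 hν hh₁pos hu₀ hdiv hH hfs hfd hA hBf0 hAle hBf₁ hsmall
  exact ⟨h₁, hh₁pos, hh₁W, u, p, hsol, h0, hub, hdt, hq, hc2⟩

/-- **Uniform `H¹` bound along every Tao-class solution from `u₀` up to `W`**, given a reference
solution on `[0, h₁]` (to which all others agree on `[0, h₁]`, Majda–Bertozzi uniqueness in the Sobolev
class) and the Kato sup bound beyond `h₁` (`norm_le_of_taoClass`): the enstrophy obeys the explicit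
`e^{κK²t}`-bound (`enstrophy_le_exp_of_norm_le_forced`) and the energy Tao's forced Lemma 8.1
(`tao2011_forced_finiteEnergy_energyBound_holds`), both uniform in the solution.
[cite: LemarieRieusset2016, Thm. 11.2 (11.11) and (11.10)] [cite: Tao2011, Lemma 8.1] -/
theorem exists_uniform_H1_bound (hν : 0 < ν) {ε₀ K : ℝ} (hK : 0 ≤ K)
    (hAK : ∀ ⦃ν T M G G₂ : ℝ⦄ ⦃g u : ℝ → EuclideanSpace ℝ (Fin 3) → EuclideanSpace ℝ (Fin 3)⦄
        ⦃p : ℝ → EuclideanSpace ℝ (Fin 3) → ℝ⦄,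
      0 < ν → 0 < T →
      IsClassicalNSSolutionOn (Icc 0 T) ν g u p → Continuous (uncurry g) →
      (∀ τ ∈ Icc 0 T, ∀ y, ‖g τ y‖ ≤ G) → (∀ τ ∈ Icc 0 T, IsWeaklyDivFree (g τ)) →
      0 ≤ G₂ → (∀ τ ∈ Icc 0 T, eLpNorm (g τ) 2 volume ≤ ENNReal.ofReal G₂) →
      (∃ C : ℝ≥0∞, C < ⊤ ∧ ∀ t ∈ Icc 0 T, ∫⁻ x, ‖u t x‖ₑ ^ 2 ≤ C) →
      0 < M → (∀ t ∈ Icc 0 T, ∀ y, ‖u t y‖ ≤ M) →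
      ContinuousOn (fun t => eLpNorm (u t) 6 volume) (Icc 0 T) →
      (eLpNorm (u 0) 3 volume).toReal / ν + T ^ (3 / 4 : ℝ) * G₂ / ν ^ (5 / 4 : ℝ) ≤ ε₀ →
      ∀ t ∈ Ioc 0 T,
        eLpNorm (u t) 6 volume ≤ ENNReal.ofReal (K *
          ((eLpNorm (u 0) 3 volume).toReal / ν + T ^ (3 / 4 : ℝ) * G₂ / ν ^ (5 / 4 : ℝ)) *
            ν ^ (3 / 4 : ℝ) * t ^ (-(1 / 4 : ℝ))) ∧
        ∀ x, ‖u t x‖ ≤ K *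
          ((eLpNorm (u 0) 3 volume).toReal / ν + T ^ (3 / 4 : ℝ) * G₂ / ν ^ (5 / 4 : ℝ)) *
            ν ^ (1 / 2 : ℝ) * t ^ (-(1 / 2 : ℝ)))
    {W : ℝ} (hW : 0 < W) {u₀ : EuclideanSpace ℝ (Fin 3) → EuclideanSpace ℝ (Fin 3)}
    {f : ℝ → EuclideanSpace ℝ (Fin 3) → EuclideanSpace ℝ (Fin 3)}
    (hfs : IsSmoothOnHalfSpace f) (hfd : HasRapidSpaceTimeDecay f) {F₂ : ℝ} (hF₂ : 0 ≤ F₂)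
    (hf2 : ∀ t ∈ Icc 0 W, eLpNorm (f t) 2 volume ≤ ENNReal.ofReal F₂)
    (hsmall : (eLpNorm u₀ 3 volume).toReal / ν + W ^ (3 / 4 : ℝ) * (4 * Real.sqrt 3 * F₂) / ν ^ (5 / 4 : ℝ) ≤ ε₀)
    {h₁ : ℝ} (hh₁ : 0 < h₁)
    {u₁ : ℝ → EuclideanSpace ℝ (Fin 3) → EuclideanSpace ℝ (Fin 3)} {p₁ : ℝ → EuclideanSpace ℝ (Fin 3) → ℝ}
    (hsol₁ : IsClassicalNSSolutionOn (Icc 0 h₁) ν f u₁ p₁) (h0₁ : u₁ 0 = u₀)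
    (hub₁ : HasBoundedSobolevNormsOn (Icc 0 h₁) u₁) :
    ∃ A : ℝ, 0 ≤ A ∧ ∀ ⦃S : ℝ⦄ ⦃u : ℝ → EuclideanSpace ℝ (Fin 3) → EuclideanSpace ℝ (Fin 3)⦄
      ⦃p : ℝ → EuclideanSpace ℝ (Fin 3) → ℝ⦄, h₁ ≤ S → S ≤ W →
      IsClassicalNSSolutionOn (Icc 0 S) ν f u p → u 0 = u₀ → HasBoundedSobolevNormsOn (Icc 0 S) u →
      ContinuousInLpOn (Icc 0 S) 2 u →
      ∀ τ ∈ Icc 0 S, (∫⁻ x, ‖u τ x‖ₑ ^ 2) +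
        (∫⁻ x, ENNReal.ofReal (frobeniusNormSq (fderiv ℝ (u τ) x))) ≤ ENNReal.ofReal A := by
  -- constants
  obtain ⟨κ, hκ0, hκ⟩ := enstrophy_le_exp_of_norm_le_forced hν
  obtain ⟨CE, hCEtop, hEn⟩ := tao2011_forced_finiteEnergy_energyBound_holds
  obtain ⟨F₀, hF₀⟩ := hfd.exists_lintegral_iteratedFDeriv_slice_sq_le_all (μ := volume) hfs 0
  obtain ⟨M₁, hM₁⟩ := linfty_bound_of_hasBoundedSobolevNormsOn_holds
    (fun t ht => (hsol₁.contDiff_velocity ht).of_le (by norm_cast)) hub₁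
  set δA : ℝ := (eLpNorm u₀ 3 volume).toReal / ν + W ^ (3 / 4 : ℝ) * (4 * Real.sqrt 3 * F₂) / ν ^ (5 / 4 : ℝ)
    with hδA
  have hδA0 : 0 ≤ δA := by positivity
  set Ku : ℝ := max (max M₁ 0) (K * δA * ν ^ (1 / 2 : ℝ) * h₁ ^ (-(1 / 2 : ℝ))) with hKu
  have hKu0 : 0 ≤ Ku := le_trans (le_max_right _ _) (le_max_left _ _)
  -- the uniform enstrophy and energy majorants
  set E₀ : ℝ≥0∞ := ∫⁻ x, ENNReal.ofReal (frobeniusNormSq (fderiv ℝ u₀ x)) with hE₀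
  set Ens : ℝ≥0∞ := ENNReal.ofReal (Real.exp (κ * (Ku ^ 2 * W))) *
    (E₀ + (ENNReal.ofReal ν)⁻¹ * ((F₀ : ℝ≥0∞) * ENNReal.ofReal W)) with hEns
  set EW : ℝ≥0∞ := CE * ((∫⁻ x, ‖u₀ x‖ₑ ^ 2) ^ (1 / 2 : ℝ) + ENNReal.ofReal F₂ * ENNReal.ofReal W) ^ 2
    with hEW
  -- finiteness (from the reference solution at time `0`)
  have hE₀top : E₀ < ⊤ := by
    obtain ⟨C₁, hC₁⟩ := hub₁ 1
    have h0 : (0 : ℝ) ∈ Icc 0 h₁ := ⟨le_rfl, hh₁.le⟩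
    calc E₀ ≤ ∫⁻ x, 3 * ‖iteratedFDeriv ℝ 1 (u₁ 0) x‖ₑ ^ 2 := lintegral_mono fun x => by
          rw [← h0₁, ← ofReal_norm, norm_iteratedFDeriv_one, ofReal_norm]
          exact ofReal_frobeniusNormSq_le_three_mul_enorm_sq _
      _ = 3 * ∫⁻ x, ‖iteratedFDeriv ℝ 1 (u₁ 0) x‖ₑ ^ 2 := lintegral_const_mul' _ _ (by norm_num)
      _ < ⊤ := ENNReal.mul_lt_top (by norm_num) ((hC₁ 0 h0).trans_lt ENNReal.coe_lt_top)
  have hU0top : ∫⁻ x, ‖u₀ x‖ₑ ^ 2 < ⊤ := by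
    obtain ⟨C₀, hC₀⟩ := hub₁ 0
    have h0 : (0 : ℝ) ∈ Icc 0 h₁ := ⟨le_rfl, hh₁.le⟩
    rw [← h0₁, ← lintegral_iteratedFDeriv_zero_eq']
    exact (hC₀ 0 h0).trans_lt ENNReal.coe_lt_top
  have hEnstop : Ens < ⊤ := by
    refine ENNReal.mul_lt_top ENNReal.ofReal_lt_top (ENNReal.add_lt_top.2 ⟨hE₀top, ?_⟩)
    refine ENNReal.mul_lt_top ?_ (ENNReal.mul_lt_top ENNReal.coe_lt_top ENNReal.ofReal_lt_top)
    exact ENNReal.inv_lt_top.2 (ENNReal.ofReal_pos.2 hν)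
  have hEWtop : EW < ⊤ := by
    refine ENNReal.mul_lt_top hCEtop (ENNReal.pow_lt_top (ENNReal.add_lt_top.2 ⟨?_, ?_⟩))
    · exact ENNReal.rpow_lt_top_of_nonneg (by norm_num) hU0top.ne
    · exact ENNReal.mul_lt_top ENNReal.ofReal_lt_top ENNReal.ofReal_lt_top
  refine ⟨(EW + Ens).toReal, ENNReal.toReal_nonneg, ?_⟩
  intro S u p hS₁ hSW hsol h0 hub hc2 τ hτ
  have hS : 0 < S := hh₁.trans_le hS₁
  rw [ENNReal.ofReal_toReal (ENNReal.add_lt_top.2 ⟨hEWtop, hEnstop⟩).ne]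
  -- ### the uniform sup bound `Ku` on `[0, S]`
  have hKuS : ∀ t ∈ Icc 0 S, ∀ x, ‖u t x‖ ≤ Ku := by
    intro t ht x
    by_cases hth : t ≤ h₁
    · -- agreement with the reference solution on `[0, h₁]`
      have hsol' : IsClassicalNSSolutionOn (Icc 0 h₁) ν f u p :=
        hsol.mono (Icc_subset_Icc_right hS₁) (uniqueDiffOn_Icc hh₁)
      have heq := hsol'.velocity_eq_of_hasBoundedSobolevNormsOn hsol₁ hν.le hh₁
        (hub.mono (Icc_subset_Icc_right hS₁)) hub₁ (by rw [h0, h0₁]) t ⟨ht.1, hth⟩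
      rw [heq]
      exact (hM₁ t ⟨ht.1, hth⟩ x).trans ((le_max_left _ _).trans (le_max_left _ _))
    · push Not at hth
      have htI : t ∈ Ioc 0 S := ⟨hh₁.trans hth, ht.2⟩
      have hf2S : ∀ s ∈ Icc 0 S, eLpNorm (f s) 2 volume ≤ ENNReal.ofReal F₂ :=
        fun s hs => hf2 s ⟨hs.1, hs.2.trans hSW⟩
      have hsmallS : (eLpNorm (u 0) 3 volume).toReal / ν +
          S ^ (3 / 4 : ℝ) * (4 * Real.sqrt 3 * F₂) / ν ^ (5 / 4 : ℝ) ≤ ε₀ := by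
        rw [h0]
        refine le_trans ?_ hsmall
        have hν54 : 0 < ν ^ (5 / 4 : ℝ) := Real.rpow_pos_of_pos hν _
        have h43 : 0 ≤ 4 * Real.sqrt 3 * F₂ := by positivity
        exact add_le_add le_rfl (div_le_div_of_nonneg_right (mul_le_mul_of_nonneg_right
          (Real.rpow_le_rpow hS.le hSW (by norm_num : (0 : ℝ) ≤ 3 / 4)) h43) hν54.le)
      have hK1 := norm_le_of_taoClass hν hAK hS hsol hub hc2 hfs hfd hF₂ hf2S hsmallS htI x
      rw [h0] at hK1
      -- `δ_A(S) ≤ δ_A(W)` and `t^{-1/2} ≤ h₁^{-1/2}`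
      have hδS : (eLpNorm u₀ 3 volume).toReal / ν +
          S ^ (3 / 4 : ℝ) * (4 * Real.sqrt 3 * F₂) / ν ^ (5 / 4 : ℝ) ≤ δA := by
        have hν54 : 0 < ν ^ (5 / 4 : ℝ) := Real.rpow_pos_of_pos hν _
        have h43 : 0 ≤ 4 * Real.sqrt 3 * F₂ := by positivity
        exact add_le_add le_rfl (div_le_div_of_nonneg_right (mul_le_mul_of_nonneg_right
          (Real.rpow_le_rpow hS.le hSW (by norm_num : (0 : ℝ) ≤ 3 / 4)) h43) hν54.le)
      have hδS0 : 0 ≤ (eLpNorm u₀ 3 volume).toReal / ν +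
          S ^ (3 / 4 : ℝ) * (4 * Real.sqrt 3 * F₂) / ν ^ (5 / 4 : ℝ) := by positivity
      have hth' : t ^ (-(1 / 2 : ℝ)) ≤ h₁ ^ (-(1 / 2 : ℝ)) :=
        Real.rpow_le_rpow_of_nonpos hh₁ hth.le (by norm_num)
      calc ‖u t x‖ ≤ K * ((eLpNorm u₀ 3 volume).toReal / ν +
            S ^ (3 / 4 : ℝ) * (4 * Real.sqrt 3 * F₂) / ν ^ (5 / 4 : ℝ)) * ν ^ (1 / 2 : ℝ) * t ^ (-(1 / 2 : ℝ)) := hK1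
        _ ≤ K * δA * ν ^ (1 / 2 : ℝ) * h₁ ^ (-(1 / 2 : ℝ)) :=
            mul_le_mul (mul_le_mul_of_nonneg_right (mul_le_mul_of_nonneg_left hδS hK)
              (Real.rpow_nonneg hν.le _)) hth' (Real.rpow_nonneg (hh₁.trans hth).le _) (by positivity)
        _ ≤ Ku := le_max_right _ _
  -- ### enstrophy at `τ`
  have hEnsτ : ∫⁻ x, ENNReal.ofReal (frobeniusNormSq (fderiv ℝ (u τ) x)) ≤ Ens := by
    have h := hκ hS hsol hub hfs hfd hKu0 hKuS hF₀ τ hτ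
    rw [h0] at h
    refine h.trans ?_
    have h1 : κ * (Ku ^ 2 * τ) ≤ κ * (Ku ^ 2 * W) :=
      mul_le_mul_of_nonneg_left (mul_le_mul_of_nonneg_left (hτ.2.trans hSW) (sq_nonneg _)) hκ0
    exact mul_le_mul' (ENNReal.ofReal_le_ofReal (Real.exp_le_exp.2 h1))
      (add_le_add le_rfl (mul_le_mul_right (mul_le_mul_right
        (ENNReal.ofReal_le_ofReal (hτ.2.trans hSW)) _) _))
  -- ### energy at `τ`
  have hEWτ : ∫⁻ x, ‖u τ x‖ₑ ^ 2 ≤ EW := by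
    have hfS : IsSmoothSpaceTimeOn (Icc 0 S) f := hfs.isSmoothSpaceTimeOn_Icc S
    have hslice : ∀ t ∈ Icc 0 S, (∫⁻ x, ‖f t x‖ₑ ^ 2) ^ (1 / 2 : ℝ) ≤ ENNReal.ofReal F₂ := by
      intro t ht
      rw [lintegral_sq_rpow_half_eq_eLpNorm]
      exact hf2 t ⟨ht.1, ht.2.trans hSW⟩
    have hfI : ∫⁻ t in Icc 0 S, (∫⁻ x, ‖f t x‖ₑ ^ 2) ^ (1 / 2 : ℝ) ≤ ENNReal.ofReal F₂ * ENNReal.ofReal W := by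
      calc ∫⁻ t in Icc 0 S, (∫⁻ x, ‖f t x‖ₑ ^ 2) ^ (1 / 2 : ℝ)
          ≤ ∫⁻ _ in Icc 0 S, ENNReal.ofReal F₂ := setLIntegral_mono' measurableSet_Icc hslice
        _ = ENNReal.ofReal F₂ * ENNReal.ofReal S := by
            rw [setLIntegral_const, Real.volume_Icc, sub_zero]
        _ ≤ ENNReal.ofReal F₂ * ENNReal.ofReal W := by gcongr
    have hfE : ∫⁻ t in Icc 0 S, (∫⁻ x, ‖f t x‖ₑ ^ 2) ^ (1 / 2 : ℝ) < ⊤ :=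
      hfI.trans_lt (ENNReal.mul_lt_top ENNReal.ofReal_lt_top ENNReal.ofReal_lt_top)
    have hE : ∃ A : ℝ≥0, ∀ t ∈ Icc 0 S, ∫⁻ x, ‖u t x‖ₑ ^ 2 ≤ A := by
      obtain ⟨C₀, hC₀⟩ := hub 0
      exact ⟨C₀, fun t ht => by rw [← lintegral_iteratedFDeriv_zero_eq']; exact hC₀ t ht⟩
    have h := (hEn hν hS hsol hfS hfE hE).1 τ hτ
    rw [h0] at h
    refine h.trans ?_
    rw [hEW]
    gcongr
  calc (∫⁻ x, ‖u τ x‖ₑ ^ 2) + (∫⁻ x, ENNReal.ofReal (frobeniusNormSq (fderiv ℝ (u τ) x)))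
      ≤ EW + Ens := add_le_add hEWτ hEnsτ

/-- **One uniform continuation step.** Given the uniform `H¹` bound `A` (valid at every time of every
Tao-class solution from `u₀` on `[0, S]`, `h₁ ≤ S ≤ W`), there is a step `h ∈ (0, h₁]` such that every
such solution on `[0, S]`, `S < W`, extends to a Tao-class solution on `[0, min(S + h/2, W)]`: restart
Tao's forced smooth existence (`smooth_existence_forced_fullSlab`) from `u(S - h/2)` with the shifted
force `f(· + S - h/2)` — the smallness `(√A + B_f)⁴ h ≤ c ν³` holds uniformly — and glue in Tao's class
(`taoClass_glue_forced`). [cite: Tao2011, Thm. 5.4 (ii)+(iv) (arXiv Thm. 31)]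
[cite: LemarieRieusset2016, Thm. 7.2 with Thm. 7.3 (pp. 125–127)] -/
theorem exists_uniform_step (hν : 0 < ν) {W : ℝ}
    {u₀ : EuclideanSpace ℝ (Fin 3) → EuclideanSpace ℝ (Fin 3)}
    {f : ℝ → EuclideanSpace ℝ (Fin 3) → EuclideanSpace ℝ (Fin 3)}
    (hfs : IsSmoothOnHalfSpace f) (hfd : HasRapidSpaceTimeDecay f)
    {h₁ : ℝ} (hh₁ : 0 < h₁) {A : ℝ} (hA : 0 ≤ A) :
    ∃ h : ℝ, 0 < h ∧ h ≤ h₁ ∧ ∀ ⦃S : ℝ⦄ ⦃u : ℝ → EuclideanSpace ℝ (Fin 3) → EuclideanSpace ℝ (Fin 3)⦄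
      ⦃p : ℝ → EuclideanSpace ℝ (Fin 3) → ℝ⦄, h₁ ≤ S → S < W →
      IsClassicalNSSolutionOn (Icc 0 S) ν f u p → u 0 = u₀ → HasBoundedSobolevNormsOn (Icc 0 S) u →
      HasBoundedSobolevNormsOn (Icc 0 S) (timeDerivWithin (Icc 0 S) u) →
      (∀ n : ℕ, ∃ C : ℝ≥0, ∀ t ∈ Icc 0 S, ∫⁻ x, ‖iteratedFDeriv ℝ n (p t) x‖ₑ ^ 2 ≤ C) →
      ContinuousInLpOn (Icc 0 S) 2 u →
      (∀ τ ∈ Icc 0 S, (∫⁻ x, ‖u τ x‖ₑ ^ 2) +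
        (∫⁻ x, ENNReal.ofReal (frobeniusNormSq (fderiv ℝ (u τ) x))) ≤ ENNReal.ofReal A) →
      ∃ (w : ℝ → EuclideanSpace ℝ (Fin 3) → EuclideanSpace ℝ (Fin 3))
        (q : ℝ → EuclideanSpace ℝ (Fin 3) → ℝ),
        IsClassicalNSSolutionOn (Icc 0 (min (S + h / 2) W)) ν f w q ∧ w 0 = u₀ ∧
        HasBoundedSobolevNormsOn (Icc 0 (min (S + h / 2) W)) w ∧
        HasBoundedSobolevNormsOn (Icc 0 (min (S + h / 2) W))
          (timeDerivWithin (Icc 0 (min (S + h / 2) W)) w) ∧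
        (∀ n : ℕ, ∃ C : ℝ≥0, ∀ t ∈ Icc 0 (min (S + h / 2) W),
          ∫⁻ x, ‖iteratedFDeriv ℝ n (q t) x‖ₑ ^ 2 ≤ C) ∧
        ContinuousInLpOn (Icc 0 (min (S + h / 2) W)) 2 w := by
  obtain ⟨c, hc, hP5⟩ := smooth_existence_forced_fullSlab tao2011_smooth_local_existence_forced_holds
  obtain ⟨Bf, hBf0, hBf⟩ := clayForce_lintegral_sqrt_eH1NormSq_translate_le hfs hfd W
  set D : ℝ := (Real.sqrt A + Bf + 1) ^ 4 with hD
  have hDpos : 0 < D := by positivity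
  set h : ℝ := min h₁ (c * ν ^ 3 / D) with hh
  have hhpos : 0 < h := lt_min hh₁ (div_pos (by positivity) hDpos)
  have hhh₁ : h ≤ h₁ := min_le_left _ _
  have hDh : D * h ≤ c * ν ^ 3 := by
    have : h ≤ c * ν ^ 3 / D := min_le_right _ _
    rwa [le_div_iff₀ hDpos, mul_comm] at this
  refine ⟨h, hhpos, hhh₁, ?_⟩
  intro S u p hS₁ hSW hsol h0 hub hdt hq hc2 hAS
  have hS : 0 < S := hh₁.trans_le hS₁
  -- the restart time `τ = S - h/2` and the local lifespan `T₂ = min h (W - τ)`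
  set τ : ℝ := S - h / 2 with hτ
  have hτ0 : 0 ≤ τ := by rw [hτ]; linarith
  have hτS : τ < S := by rw [hτ]; linarith
  have hτI : τ ∈ Icc 0 S := ⟨hτ0, hτS.le⟩
  set T₂ : ℝ := min h (W - τ) with hT₂
  have hT₂pos : 0 < T₂ := lt_min hhpos (by rw [hτ]; linarith)
  have hT₂h : T₂ ≤ h := min_le_left _ _
  have hT₂W : T₂ ≤ W := by
    have : T₂ ≤ W - τ := min_le_right _ _
    linarith
  have hmin : τ + T₂ = min (S + h / 2) W := by
    rw [hT₂, hτ]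
    rcases le_total h (W - (S - h / 2)) with hle | hle
    · rw [min_eq_left hle, min_eq_left (by linarith)]; ring
    · rw [min_eq_right hle, min_eq_right (by linarith)]; ring
  -- smallness on the piece
  have hsmall : (Real.sqrt A + Bf) ^ 4 * T₂ ≤ c * ν ^ 3 := by
    have h1 : (Real.sqrt A + Bf) ^ 4 ≤ D := pow_le_pow_left₀ (by positivity) (by linarith) 4
    have h2 : (Real.sqrt A + Bf) ^ 4 * T₂ ≤ D * h :=
      mul_le_mul h1 hT₂h hT₂pos.le hDpos.le
    exact h2.trans hDh
  -- the datum `u τ` and the shifted force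
  have hvτ : ContDiff ℝ ∞ (u τ) := hsol.contDiff_velocity hτI
  have hdivτ : VectorCalculus.IsDivFree (u τ) := hsol.divFree τ hτI
  have hHτ : ∀ n : ℕ, ∫⁻ x, ‖iteratedFDeriv ℝ n (u τ) x‖ₑ ^ 2 < ⊤ := fun n => by
    obtain ⟨C, hC⟩ := hub n
    exact (hC τ hτI).trans_lt ENNReal.coe_lt_top
  have hfs' : IsSmoothOnHalfSpace (fun s => f (s + τ)) := hfs.timeShift hτ0
  have hfd' : HasRapidSpaceTimeDecay (fun s => f (s + τ)) := hfd.timeShift hfs hτ0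
  have hBτ : ∫⁻ t in Ioo 0 T₂, eH1NormSq (f (t + τ)) ^ (2⁻¹ : ℝ) ≤ ENNReal.ofReal Bf := hBf τ hτ0 T₂ hT₂W
  -- Tao's forced smooth existence on `[0, T₂]` from `u τ`
  obtain ⟨u₂, p₂, hsol₂, h0₂, hub₂, hdt₂, hq₂, hc2₂⟩ :=
    hP5 hν hT₂pos hvτ hdivτ hHτ hfs' hfd' hA hBf0 (hAS τ hτI) hBτ hsmall
  -- glue in Tao's class
  obtain ⟨w, q, hsolw, hw0, hubw, hdtw, hqw, hc2w, -⟩ :=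
    taoClass_glue_forced hsol hub hdt hq hc2 hsol₂ hub₂ hdt₂ hq₂ hc2₂ h0₂ hν hT₂pos hτ0 hτS
      (by rw [hτ, hT₂]; rcases le_total h (W - (S - h / 2)) with hle | hle
          · rw [min_eq_left hle]; linarith
          · rw [min_eq_right hle]; linarith)
  refine ⟨w, q, ?_⟩
  rw [← hmin]
  exact ⟨hsolw, by rw [hw0, h0], hubw, hdtw, hqw, hc2w⟩

/-- **Tao-class classical solution on the FULL slab `[0, W]` for Kato-small data** (the existence half
of `SmallDataClassicalEngine`): under the smallness `‖u₀‖₃/ν + W^{3/4}(4√3 F₂)/ν^{5/4} ≤ ε₀` (with the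
constants of `KatoAprioriForced.kato_apriori_forced`), a smooth compactly supported divergence-free
datum and a Clay-class force with `‖f(t)‖₂ ≤ F₂` on `[0, W]` generate a classical solution on
`[0, W] × ℝ³` in Tao's class (first package, uniform `H¹` bound, uniform-step continuation by
induction). [cite: Kato1984, Thm. 2–4] [cite: LemarieRieusset2016, Thm. 15.2 with Thm. 7.2/7.3] -/
theorem exists_classical_fullSlab (hν : 0 < ν) {ε₀ K : ℝ} (hK : 0 ≤ K)
    (hAK : ∀ ⦃ν T M G G₂ : ℝ⦄ ⦃g u : ℝ → EuclideanSpace ℝ (Fin 3) → EuclideanSpace ℝ (Fin 3)⦄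
        ⦃p : ℝ → EuclideanSpace ℝ (Fin 3) → ℝ⦄,
      0 < ν → 0 < T →
      IsClassicalNSSolutionOn (Icc 0 T) ν g u p → Continuous (uncurry g) →
      (∀ τ ∈ Icc 0 T, ∀ y, ‖g τ y‖ ≤ G) → (∀ τ ∈ Icc 0 T, IsWeaklyDivFree (g τ)) →
      0 ≤ G₂ → (∀ τ ∈ Icc 0 T, eLpNorm (g τ) 2 volume ≤ ENNReal.ofReal G₂) →
      (∃ C : ℝ≥0∞, C < ⊤ ∧ ∀ t ∈ Icc 0 T, ∫⁻ x, ‖u t x‖ₑ ^ 2 ≤ C) →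
      0 < M → (∀ t ∈ Icc 0 T, ∀ y, ‖u t y‖ ≤ M) →
      ContinuousOn (fun t => eLpNorm (u t) 6 volume) (Icc 0 T) →
      (eLpNorm (u 0) 3 volume).toReal / ν + T ^ (3 / 4 : ℝ) * G₂ / ν ^ (5 / 4 : ℝ) ≤ ε₀ →
      ∀ t ∈ Ioc 0 T,
        eLpNorm (u t) 6 volume ≤ ENNReal.ofReal (K *
          ((eLpNorm (u 0) 3 volume).toReal / ν + T ^ (3 / 4 : ℝ) * G₂ / ν ^ (5 / 4 : ℝ)) *
            ν ^ (3 / 4 : ℝ) * t ^ (-(1 / 4 : ℝ))) ∧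
        ∀ x, ‖u t x‖ ≤ K *
          ((eLpNorm (u 0) 3 volume).toReal / ν + T ^ (3 / 4 : ℝ) * G₂ / ν ^ (5 / 4 : ℝ)) *
            ν ^ (1 / 2 : ℝ) * t ^ (-(1 / 2 : ℝ)))
    {W : ℝ} (hW : 0 < W) {u₀ : EuclideanSpace ℝ (Fin 3) → EuclideanSpace ℝ (Fin 3)}
    (hu₀ : ContDiff ℝ ∞ u₀) (hu₀c : HasCompactSupport u₀) (hdiv : VectorCalculus.IsDivFree u₀)
    {f : ℝ → EuclideanSpace ℝ (Fin 3) → EuclideanSpace ℝ (Fin 3)}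
    (hfs : IsSmoothOnHalfSpace f) (hfd : HasRapidSpaceTimeDecay f) {F₂ : ℝ} (hF₂ : 0 ≤ F₂)
    (hf2 : ∀ t ∈ Icc 0 W, eLpNorm (f t) 2 volume ≤ ENNReal.ofReal F₂)
    (hsmall : (eLpNorm u₀ 3 volume).toReal / ν + W ^ (3 / 4 : ℝ) * (4 * Real.sqrt 3 * F₂) / ν ^ (5 / 4 : ℝ) ≤ ε₀) :
    ∃ (u : ℝ → EuclideanSpace ℝ (Fin 3) → EuclideanSpace ℝ (Fin 3)) (p : ℝ → EuclideanSpace ℝ (Fin 3) → ℝ),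
      IsClassicalNSSolutionOn (Icc 0 W) ν f u p ∧ u 0 = u₀ ∧ HasBoundedSobolevNormsOn (Icc 0 W) u ∧
      ContinuousInLpOn (Icc 0 W) 2 u := by
  obtain ⟨h₁, hh₁, hh₁W, u₁, p₁, hsol₁, h0₁, hub₁, hdt₁, hq₁, hc2₁⟩ :=
    exists_first_taoClass hν hW hu₀ hu₀c hdiv hfs hfd
  obtain ⟨A, hA, hAu⟩ := exists_uniform_H1_bound hν hK hAK hW hfs hfd hF₂ hf2 hsmall hh₁ hsol₁ h0₁ hub₁
  obtain ⟨h, hh, -, hstep⟩ := exists_uniform_step hν (W := W) (u₀ := u₀) hfs hfd hh₁ hA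
  -- induction on the number of steps
  have hind : ∀ n : ℕ, ∃ S : ℝ, min W (h₁ + n * (h / 2)) ≤ S ∧ S ≤ W ∧ h₁ ≤ S ∧
      ∃ (u : ℝ → EuclideanSpace ℝ (Fin 3) → EuclideanSpace ℝ (Fin 3)) (p : ℝ → EuclideanSpace ℝ (Fin 3) → ℝ),
        IsClassicalNSSolutionOn (Icc 0 S) ν f u p ∧ u 0 = u₀ ∧ HasBoundedSobolevNormsOn (Icc 0 S) u ∧
        HasBoundedSobolevNormsOn (Icc 0 S) (timeDerivWithin (Icc 0 S) u) ∧
        (∀ n : ℕ, ∃ C : ℝ≥0, ∀ t ∈ Icc 0 S, ∫⁻ x, ‖iteratedFDeriv ℝ n (p t) x‖ₑ ^ 2 ≤ C) ∧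
        ContinuousInLpOn (Icc 0 S) 2 u := by
    intro n
    induction n with
    | zero =>
      refine ⟨h₁, ?_, hh₁W, le_rfl, u₁, p₁, hsol₁, h0₁, hub₁, hdt₁, hq₁, hc2₁⟩
      simp only [Nat.cast_zero, zero_mul, add_zero]
      exact min_le_right _ _
    | succ n ih =>
      obtain ⟨S, hS₁, hSW, hh₁S, u, p, hsol, h0, hub, hdt, hq, hc2⟩ := ih
      rcases hSW.eq_or_lt with hEq | hlt
      · refine ⟨S, ?_, hSW, hh₁S, u, p, hsol, h0, hub, hdt, hq, hc2⟩
        rw [hEq]; exact min_le_left _ _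
      · obtain ⟨w, q, hw⟩ := hstep hh₁S hlt hsol h0 hub hdt hq hc2 (hAu hh₁S hSW hsol h0 hub hc2)
        refine ⟨min (S + h / 2) W, ?_, min_le_right _ _, le_min (by linarith) hh₁W, w, q, hw⟩
        have hX : h₁ + n * (h / 2) ≤ S := by
          rcases le_total (h₁ + n * (h / 2)) W with hle | hle
          · rwa [min_eq_right hle] at hS₁
          · rw [min_eq_left hle] at hS₁; linarith
        push_cast
        refine le_min ((min_le_right _ _).trans (by linarith)) (min_le_left _ _)
  -- enough steps to reach `W`
  obtain ⟨n, hn⟩ := exists_nat_ge (2 * W / h)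
  obtain ⟨S, hS₁, hSW, -, u, p, hsol, h0, hub, -, -, hc2⟩ := hind n
  have hreach : W ≤ h₁ + n * (h / 2) := by
    have h1 : 2 * W ≤ n * h := by
      have := mul_le_mul_of_nonneg_right hn hh.le
      rwa [div_mul_cancel₀ _ hh.ne'] at this
    linarith
  have hSW' : S = W := le_antisymm hSW (by rwa [min_eq_left hreach] at hS₁)
  subst hSW'
  exact ⟨u, p, hsol, h0, hub, hc2⟩

end Existence

/-! ### §5 The engine: Kato's small-data theorem with a confined Clay force, classical output -/

section Engine

variable {ν : ℝ}

/-- `√3 ≤ 7/4`, so `4√3 · 3 ≤ 21`. [folklore] -/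
private theorem twelve_sqrt_three_le : 4 * Real.sqrt 3 * 3 ≤ 21 := by
  have h : Real.sqrt 3 ≤ 7 / 4 := by
    rw [show (7 : ℝ) / 4 = Real.sqrt ((7 / 4) ^ 2) by rw [Real.sqrt_sq (by norm_num)]]
    exact Real.sqrt_le_sqrt (by norm_num)
  linarith

/-- `√(ν/W) = ν^{1/2} W^{-1/2}` for `ν, W > 0`. [folklore] -/
private theorem sqrt_div_eq_rpow {ν W : ℝ} (hν : 0 < ν) (hW : 0 < W) :
    Real.sqrt (ν / W) = ν ^ (1 / 2 : ℝ) * W ^ (-(1 / 2 : ℝ)) := by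
  rw [Real.sqrt_eq_rpow, Real.div_rpow hν.le hW.le, Real.rpow_neg hW.le, div_eq_mul_inv]

/-- **Kato's small-data theorem WITH a confined Clay-class force, classical output** — the cell
`ns-blowup`'s typed hypothesis `SmallDataClassicalEngine ν`, for every `ν > 0` (Kato 1984, Thm. 2–4 in
the weighted class `t^{1/4}L⁶ ∩ t^{1/2}L^∞`; Lemarié-Rieusset 2016, Thm. 15.2, with the forced `H^∞`
theory Thm. 7.2/7.3 — here Tao 2013, Thm. 5.4 — supplying smoothness and the pressure). There is
`ε > 0` such that: for every slab `[t₀, t₁]` (`0 ≤ t₀ < t₁`), every smooth compactly supported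
divergence-free datum `u₀`, every force `g` smooth on the closed half-space with Fefferman's decay,
vanishing off `B̄(0, R)` and bounded by `M` on the slab, IF
`‖u₀‖₃/ν + W^{1/2} M R²/ν^{3/2} + W^{3/4} M R^{3/2}/ν^{5/4} ≤ ε` (`W = t₁ - t₀`), THEN there is a
classical solution `(v, q)` of the forced system on `[t₀, t₁] × ℝ³` with `v(t₀) = u₀`, bounded, of finite
energy, with `|v(t₁, x)| ≤ ε⁻¹ (δ₁ + δ₂ + δ₃) (ν/W)^{1/2}` for all `x`.
[cite: Kato1984, Thm. 2–4] [cite: LemarieRieusset2016, Thm. 15.2 with Thm. 7.2/7.3] [cite: Tao2011, Thm. 5.4 (ii)+(iv)] -/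
theorem kato_smallData_forced_classical (hν : 0 < ν) :
    ∃ ε : ℝ, 0 < ε ∧
      ∀ (t₀ t₁ : ℝ), 0 ≤ t₀ → t₀ < t₁ →
      ∀ (u₀ : EuclideanSpace ℝ (Fin 3) → EuclideanSpace ℝ (Fin 3))
        (g : ℝ → EuclideanSpace ℝ (Fin 3) → EuclideanSpace ℝ (Fin 3)) (R M : ℝ),
        ContDiff ℝ ∞ u₀ → HasCompactSupport u₀ → VectorCalculus.IsDivFree u₀ →
        IsSmoothOnHalfSpace g → HasRapidSpaceTimeDecay g →
        0 ≤ R → (∀ t x, R < ‖x‖ → g t x = 0) →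
        0 ≤ M → (∀ t ∈ Icc t₀ t₁, ∀ x, ‖g t x‖ ≤ M) →
        (eLpNorm u₀ 3 volume).toReal / ν +
            Real.sqrt (t₁ - t₀) * M * R ^ 2 / ν ^ (3 / 2 : ℝ) +
            (t₁ - t₀) ^ (3 / 4 : ℝ) * M * R ^ (3 / 2 : ℝ) / ν ^ (5 / 4 : ℝ) ≤ ε →
        ∃ (v : ℝ → EuclideanSpace ℝ (Fin 3) → EuclideanSpace ℝ (Fin 3))
          (q : ℝ → EuclideanSpace ℝ (Fin 3) → ℝ),
          IsClassicalNSSolutionOn (Icc t₀ t₁) ν g v q ∧ v t₀ = u₀ ∧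
          (∃ B : ℝ, ∀ t ∈ Icc t₀ t₁, ∀ x, ‖v t x‖ ≤ B) ∧
          (∃ C : ℝ≥0∞, C < ⊤ ∧ ∀ t ∈ Icc t₀ t₁, ∫⁻ x, ‖v t x‖ₑ ^ 2 ≤ C) ∧
          ∀ x, ‖v t₁ x‖ ≤ ε⁻¹ *
            ((eLpNorm u₀ 3 volume).toReal / ν +
              Real.sqrt (t₁ - t₀) * M * R ^ 2 / ν ^ (3 / 2 : ℝ) +
              (t₁ - t₀) ^ (3 / 4 : ℝ) * M * R ^ (3 / 2 : ℝ) / ν ^ (5 / 4 : ℝ)) *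
            Real.sqrt (ν / (t₁ - t₀)) := by
  obtain ⟨ε₀, K, hε₀, hK, hAK⟩ := KatoAprioriForced.kato_apriori_forced
  set ε : ℝ := min (ε₀ / 21) (1 / (21 * K)) with hε
  have hεpos : 0 < ε := lt_min (by positivity) (by positivity)
  have hε₁ : 21 * ε ≤ ε₀ := by
    have : ε ≤ ε₀ / 21 := min_le_left _ _
    linarith
  have hε₂ : 21 * K ≤ ε⁻¹ := by
    have h1 : ε ≤ 1 / (21 * K) := min_le_right _ _
    rw [le_inv_comm₀ (by positivity) hεpos]
    simpa [one_div] using h1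
  refine ⟨ε, hεpos, ?_⟩
  intro t₀ t₁ ht₀ ht₀₁ u₀ g R M hu₀ hu₀c hdiv hgs hgd hR hgfar hM hgM hδ
  set W : ℝ := t₁ - t₀ with hWdef
  have hW : 0 < W := by rw [hWdef]; linarith
  set δ : ℝ := (eLpNorm u₀ 3 volume).toReal / ν + Real.sqrt W * M * R ^ 2 / ν ^ (3 / 2 : ℝ) +
    W ^ (3 / 4 : ℝ) * M * R ^ (3 / 2 : ℝ) / ν ^ (5 / 4 : ℝ) with hδdef
  have hδε : δ ≤ ε := hδ
  -- the shifted force `f(s) = g(s + t₀)` and the `L²` size of its slices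
  set f : ℝ → EuclideanSpace ℝ (Fin 3) → EuclideanSpace ℝ (Fin 3) := fun s => g (s + t₀) with hfdef
  have hfs : IsSmoothOnHalfSpace f := hgs.timeShift ht₀
  have hfd : HasRapidSpaceTimeDecay f := hgd.timeShift hgs ht₀
  set F₂ : ℝ := 3 * M * R ^ (3 / 2 : ℝ) with hF₂
  have hF₂0 : 0 ≤ F₂ := by positivity
  have hf2 : ∀ s ∈ Icc 0 W, eLpNorm (f s) 2 volume ≤ ENNReal.ofReal F₂ := by
    intro s hs
    have hsI : s + t₀ ∈ Icc t₀ t₁ := ⟨by linarith [hs.1], by rw [hWdef] at hs; linarith [hs.2]⟩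
    have hcont : Continuous (f s) :=
      ((hfs.isSmoothSpaceTimeOn_Icc W).contDiff_slice hs).continuous
    exact eLpNorm_two_le_of_confined hcont hR hM (fun x hx => hgfar (s + t₀) x hx)
      (fun x => hgM (s + t₀) hsI x)
  -- Kato smallness for the a-priori bound: `δ_A ≤ 21 δ ≤ ε₀`
  set δA : ℝ := (eLpNorm u₀ 3 volume).toReal / ν + W ^ (3 / 4 : ℝ) * (4 * Real.sqrt 3 * F₂) / ν ^ (5 / 4 : ℝ)
    with hδA
  have hδ1 : 0 ≤ (eLpNorm u₀ 3 volume).toReal / ν := by positivity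
  have hδ2 : 0 ≤ Real.sqrt W * M * R ^ 2 / ν ^ (3 / 2 : ℝ) := by positivity
  have hδ3 : 0 ≤ W ^ (3 / 4 : ℝ) * M * R ^ (3 / 2 : ℝ) / ν ^ (5 / 4 : ℝ) := by positivity
  have hδ0 : 0 ≤ δ := by rw [hδdef]; positivity
  have hδAle : δA ≤ 21 * δ := by
    have h3 : W ^ (3 / 4 : ℝ) * (4 * Real.sqrt 3 * F₂) / ν ^ (5 / 4 : ℝ) =
        (4 * Real.sqrt 3 * 3) * (W ^ (3 / 4 : ℝ) * M * R ^ (3 / 2 : ℝ) / ν ^ (5 / 4 : ℝ)) := by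
      rw [hF₂]; ring
    rw [hδA, h3, hδdef]
    nlinarith [twelve_sqrt_three_le, hδ1, hδ2, hδ3]
  have hsmall : δA ≤ ε₀ := hδAle.trans ((mul_le_mul_of_nonneg_left hδε (by norm_num)).trans hε₁)
  -- the classical solution on `[0, W]` with force `f`
  obtain ⟨u, p, hsol, h0, hub, hc2⟩ :=
    exists_classical_fullSlab hν hK.le hAK hW hu₀ hu₀c hdiv hfs hfd hF₂0 hf2 hsmall
  obtain ⟨Cb, hCb⟩ := linfty_bound_of_hasBoundedSobolevNormsOn_holds
    (fun t ht => (hsol.contDiff_velocity ht).of_le (by norm_cast)) hub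
  -- Kato's bound at the final time `W`
  have hKato : ∀ x, ‖u W x‖ ≤ K * δA * ν ^ (1 / 2 : ℝ) * W ^ (-(1 / 2 : ℝ)) := by
    intro x
    have h := norm_le_of_taoClass hν hAK hW hsol hub hc2 hfs hfd hF₂0 hf2 (by rwa [h0])
      ⟨hW, le_rfl⟩ x
    rwa [h0] at h
  -- shift back to `[t₀, t₁]`
  have hshift := hsol.comp_add_right (-t₀)
  have hset : ((· + -t₀) ⁻¹' Icc 0 W : Set ℝ) = Icc t₀ t₁ := by
    ext t
    simp only [mem_preimage, mem_Icc, hWdef]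
    constructor <;> intro h <;> constructor <;> linarith [h.1, h.2]
  have hforce : (fun t => f (t + -t₀)) = g := by
    funext t; simp only [hfdef]; congr 1; ring
  rw [hset, hforce] at hshift
  refine ⟨fun t => u (t + -t₀), fun t => p (t + -t₀), hshift, ?_, ?_, ?_, ?_⟩
  · show u (t₀ + -t₀) = u₀
    rw [add_neg_cancel, h0]
  · refine ⟨Cb, fun t ht x => hCb (t + -t₀) ?_ x⟩
    rw [hWdef]; exact ⟨by linarith [ht.1], by linarith [ht.2]⟩
  · obtain ⟨C₀, hC₀⟩ := hub 0
    refine ⟨C₀, ENNReal.coe_lt_top, fun t ht => ?_⟩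
    have htI : t + -t₀ ∈ Icc 0 W := by rw [hWdef]; exact ⟨by linarith [ht.1], by linarith [ht.2]⟩
    have h := hC₀ (t + -t₀) htI
    rwa [lintegral_iteratedFDeriv_zero_eq'] at h
  · intro x
    have ht₁ : t₁ + -t₀ = W := by rw [hWdef]; ring
    show ‖u (t₁ + -t₀) x‖ ≤ _
    rw [ht₁]
    calc ‖u W x‖ ≤ K * δA * ν ^ (1 / 2 : ℝ) * W ^ (-(1 / 2 : ℝ)) := hKato x
      _ ≤ K * (21 * δ) * ν ^ (1 / 2 : ℝ) * W ^ (-(1 / 2 : ℝ)) := by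
          have : 0 ≤ ν ^ (1 / 2 : ℝ) * W ^ (-(1 / 2 : ℝ)) := by positivity
          nlinarith [mul_le_mul_of_nonneg_left hδAle hK.le]
      _ = (21 * K) * δ * (ν ^ (1 / 2 : ℝ) * W ^ (-(1 / 2 : ℝ))) := by ring
      _ ≤ ε⁻¹ * δ * (ν ^ (1 / 2 : ℝ) * W ^ (-(1 / 2 : ℝ))) := by
          have : 0 ≤ δ * (ν ^ (1 / 2 : ℝ) * W ^ (-(1 / 2 : ℝ))) := by positivity
          nlinarith
      _ = ε⁻¹ * δ * Real.sqrt (ν / W) := by rw [sqrt_div_eq_rpow hν hW]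

end Engine






end KatoSmallDataForced

end Literature.Analysis.FluidPDE

end
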